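import Mathlib.NumberTheory.ArithmeticFunction.Moebius
import Mathlib.NumberTheory.EulerProduct.Basic
import Mathlib.Analysis.SpecialFunctions.Pow.Real
import Mathlib.Analysis.PSeries
import Mathlib.NumberTheory.Harmonic.Bounds
import Mathlib.Algebra.Order.Floor.Semifield
import Literature.NumberTheory.LFunctions.TaoLogElliottSection2
import HarnessLib

/-!
# Tao's log-averaged Elliott theorem: Proposition 2.2 (reduction to completely multiplicative `g`)

Fourth layer of the proof DAG below the named fact `Literature.NumberTheory.LFunctions.tao_log_averaged_elliott_two`
(Tao, Forum Math. Pi 4 (2016) e8, Theorem 1.3).  `TaoLogElliottSection2.lean` records the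
printed steps of §2 of the paper as named facts; here two of them are PROVED, following the
printed proof of Proposition 2.2 line by line:

* `Literature.Tao2016_prop22_holds : Tao2016_prop22` — Theorem 1.3 for (`g₁` completely
  multiplicative `S¹`-valued, `g₂` `S¹`-valued) implies Theorem 1.3 for `S¹`-valued `g₁, g₂`;
* `Literature.Tao2016_prop22_right_holds : Tao2016_prop22_right` — its `g₂`-analogue ("A similar
  argument allows one to also reduce to the case where `g₂` is completely multiplicative").

Contents (all proved; no new named facts):

* `Literature.cmLift g` — the completely multiplicative `g̃` with `g̃(p) = g(p)`; `Literature.cmDefect g` — the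
  multiplicative `h` with `g = g̃ * h` (`cmLift_mul_cmDefect`, twisted Möbius inversion),
  `h(p) = 0`, `|h(p^j)| ≤ 2` (`cmDefect_prime`, `norm_cmDefect_prime_pow_le`), `|h(d)| ≤ d`;
* `Literature.NumberTheory.LFunctions.sum_defectWeight_le` — "from taking Euler products one sees that
  `∑_d |h(d)| d^{-2/3} = O(1)`": `∑_{d ≤ D} |h(d)| d^{-2/3} ≤ C := exp(7 ∑_n n^{-4/3})`
  (`Literature.NumberTheory.LFunctions.cmDefectBound`), uniformly in the `1`-bounded multiplicative `g`;
* elementary finite-sum lemmas (harmonic bounds, residue classes `n ≡ r (d)` in `(L, U]`,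
  the change of variables `n = d n' + r`: `residueClass_sum_bound`; the passage from the
  log-averaged hypothesis to all tails: `tail_bound_of_oracle`; the large-`d` bound
  `∑_{L<n≤U, d∣an+b} 1/n ≤ (2a/d)(1 + log(2a(1 + U/(L+1))))`: `sum_inv_filter_dvd_le`);
* `Literature.NumberTheory.LFunctions.logCorrelation_eq_sum_cmDefect` — the rewriting of the correlation as
  `∑_d h(d) ∑_{d ∣ a₁n+b₁} g̃₁((a₁n+b₁)/d) g₂(a₂n+b₂)/n`;
* `Literature.NumberTheory.LFunctions.Tao2016_nonpretentiousAt.transfer` — hypothesis (1.5) passes from height `x` to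
  `x' ≤ x` at the cost `2(1 + log(x/x'))` in the level, and only involves prime values
  (`.congr_primes`), so it holds for `g̃₁`;
* `Literature.NumberTheory.LFunctions.cm_reduction_core` — the printed argument for one decomposed function against a
  `1`-bounded one, with explicit constants: small `d ≤ K` (the paper's `A₀`) via the hypothesis
  ("oracle") after the change of variables, large `d > K` via the triangle inequality;
* `Literature.NumberTheory.LFunctions.prop22_engine` — choice of `K` (`prop22_exists_cutoff`: `2aC K^{-1/3} ≤ ε/8`), of the
  thresholds of the finitely many instances `(d, r)` of the hypothesis, of `A`, and the final
  bookkeeping (`prop22_final_arith`); both propositions are instances of the engine (the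
  correlation being symmetric, `logCorrelation_swap`).

## References
* T. Tao, *The logarithmically averaged Chowla and Elliott conjectures for two-point
  correlations*, Forum Math. Pi 4 (2016), e8; arXiv:1509.05422, §2, Proposition 2.2 and the
  sentence following its proof.

## Design choices / deviations from the printed constants
* The paper replaces `ε` by `ε/2A₀³` and bounds `|h(d)| ≤ A₀`, the number of residues by `A₀`;
  we use `ε' = ε/(4K³)`, `|h(d)| ≤ d ≤ K`, at most `d ≤ K` residues, and the explicit error `4`
  per residue class for the change of variables (`n' = 0` term, `1/(dn'+r)` versus `1/(dn')`,
  and the tail with `P = 0`), so that the small-`d` total is `K³(4 + ε'(log 4 + log ω))`.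
* The hypothesis is invoked at height `x' = (x - r)/d` (so that `⌊x'⌋ = (⌊x⌋ - r)/d` exactly) and
  at every `ω' = x'/P`, `P ≥ 1`, at level `A' = A/8K`; hypothesis (1.5) for `g̃₁` at `(A', x')`
  follows from (1.5) for `g₁` at `(A, x)` since `∑_{x'<p≤x} 2/p ≤ 2(1 + log(x/x')) ≤ 2(1 + 2K)`.
* `A` is taken `≥ max(8K T₀ + 8K + 4, exp ℓ₀)` where `T₀` dominates the thresholds of the
  instances `(d, r) ∈ [0, K]²` of the hypothesis and `ℓ₀ = (8/5ε)(4K³ + (ε/4) log 4 +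
  (ε/8)(1 + log 4a))`.
-/

open Finset Complex ArithmeticFunction

namespace Literature.NumberTheory.LFunctions

section CM

/-! ### The completely multiplicative function with the same prime values -/

/-- The completely multiplicative arithmetic function `g̃` with `g̃(p) = g(p)` at every prime:
`g̃(n) = ∏_{p^k ‖ n} g(p)^k` (`g̃(0) = 0`).  (Tao 2016, proof of Prop. 2.2: "the completely
multiplicative function `g̃₁` with `g̃₁(p) = g₁(p)` for all `p`".)
[cite: TaoFMP2016, proof of Proposition 2.2] -/
noncomputable def cmLift (g : ArithmeticFunction ℂ) : ArithmeticFunction ℂ where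
  toFun n := if n = 0 then 0 else n.factorization.prod fun p k => g p ^ k
  map_zero' := by simp

variable (g : ArithmeticFunction ℂ)

/-- The defining formula `g̃(n) = ∏_{p^k ‖ n} g(p)^k` for `n ≠ 0`. [folklore] -/
theorem cmLift_apply_ne_zero {n : ℕ} (hn : n ≠ 0) :
    cmLift g n = n.factorization.prod fun p k => g p ^ k := by
  simp [cmLift, hn]

/-- `g̃(1) = 1`. [folklore] -/
@[simp] theorem cmLift_one : cmLift g 1 = 1 := by
  rw [cmLift_apply_ne_zero g one_ne_zero, Nat.factorization_one, Finsupp.prod_zero_index]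

/-- `g̃` is completely multiplicative: `g̃(mn) = g̃(m) g̃(n)` for all `m, n`.
[cite: TaoFMP2016, proof of Proposition 2.2] -/
theorem cmLift_mul (m n : ℕ) : cmLift g (m * n) = cmLift g m * cmLift g n := by
  rcases eq_or_ne m 0 with rfl | hm
  · simp
  rcases eq_or_ne n 0 with rfl | hn
  · simp
  rw [cmLift_apply_ne_zero g hm, cmLift_apply_ne_zero g hn,
    cmLift_apply_ne_zero g (mul_ne_zero hm hn), Nat.factorization_mul hm hn,
    Finsupp.prod_add_index' (fun _ => pow_zero _) (fun _ _ _ => pow_add _ _ _)]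

/-- `g̃(p^k) = g(p)^k`. [folklore] -/
theorem cmLift_prime_pow {p : ℕ} (hp : p.Prime) (k : ℕ) : cmLift g (p ^ k) = g p ^ k := by
  rw [cmLift_apply_ne_zero g (pow_ne_zero k hp.ne_zero), hp.factorization_pow,
    Finsupp.prod_single_index (by simp)]

/-- `g̃(p) = g(p)` ("`g̃₁(p) = g₁(p)` for all `p`"). [cite: TaoFMP2016, proof of Proposition 2.2] -/
theorem cmLift_prime {p : ℕ} (hp : p.Prime) : cmLift g p = g p := by
  simpa using cmLift_prime_pow g hp 1

/-- `g̃` is multiplicative. [folklore] -/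
theorem isMultiplicative_cmLift : (cmLift g).IsMultiplicative :=
  ⟨cmLift_one g, fun {m n} _ => cmLift_mul g m n⟩

/-- If `|g(p)| ≤ 1` at primes then `|g̃(n)| ≤ 1` for all `n`. [folklore] -/
theorem norm_cmLift_le_one (hg : ∀ p : ℕ, p.Prime → ‖g p‖ ≤ 1) (n : ℕ) : ‖cmLift g n‖ ≤ 1 := by
  induction n using Nat.recOnPosPrimePosCoprime with
  | prime_pow p k hp hk =>
    rw [cmLift_prime_pow g hp, norm_pow]
    exact pow_le_one₀ (norm_nonneg _) (hg p hp)
  | zero => simp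
  | one => simp
  | coprime m n hm hn hmn ihm ihn =>
    rw [cmLift_mul, norm_mul]
    exact mul_le_one₀ ihm (norm_nonneg _) ihn

/-- If `|g(p)| = 1` at primes then `|g̃(n)| = 1` for all `n ≥ 1` ("Clearly, `g̃₁` takes values in
`S¹`"). [cite: TaoFMP2016, proof of Proposition 2.2] -/
theorem norm_cmLift_eq_one (hg : ∀ p : ℕ, p.Prime → ‖g p‖ = 1) {n : ℕ} (hn : n ≠ 0) :
    ‖cmLift g n‖ = 1 := by
  induction n using Nat.recOnPosPrimePosCoprime with
  | prime_pow p k hp hk => rw [cmLift_prime_pow g hp, norm_pow, hg p hp, one_pow]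
  | zero => exact absurd rfl hn
  | one => simp
  | coprime m n hm hn' hmn ihm ihn =>
    rw [cmLift_mul, norm_mul, ihm (by omega), ihn (by omega), one_mul]

/-! ### The twisted Möbius function `μ g̃` and the defect `h = g * (μ g̃)` -/

/-- `μ · g̃`, the Dirichlet inverse of the completely multiplicative `g̃` (the twist in "Möbius
inversion (twisted by `g̃₁`)"). [cite: TaoFMP2016, proof of Proposition 2.2] -/
noncomputable def cmLiftInv : ArithmeticFunction ℂ :=
  (ArithmeticFunction.moebius : ArithmeticFunction ℂ).pmul (cmLift g)

/-- `(μ g̃)(n) = μ(n) g̃(n)`. [folklore] -/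
theorem cmLiftInv_apply (n : ℕ) :
    cmLiftInv g n = (ArithmeticFunction.moebius n : ℂ) * cmLift g n := by
  simp [cmLiftInv, pmul_apply]

/-- `μ g̃` is multiplicative. [folklore] -/
theorem isMultiplicative_cmLiftInv : (cmLiftInv g).IsMultiplicative :=
  ArithmeticFunction.isMultiplicative_moebius.intCast.pmul (isMultiplicative_cmLift g)

/-- `g̃ * (μ g̃) = δ`: Möbius inversion twisted by a completely multiplicative function.
[folklore] -/
theorem cmLift_mul_cmLiftInv : cmLift g * cmLiftInv g = 1 := by
  ext n
  rw [mul_apply]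
  have : ∀ x ∈ n.divisorsAntidiagonal,
      cmLift g x.1 * cmLiftInv g x.2 = cmLift g n * (ArithmeticFunction.moebius x.2 : ℂ) := by
    intro x hx
    rw [cmLiftInv_apply, ← (Nat.mem_divisorsAntidiagonal.mp hx).1, cmLift_mul]
    ring
  rw [Finset.sum_congr rfl this, ← Finset.mul_sum,
    Nat.sum_divisorsAntidiagonal' (fun _ e => (ArithmeticFunction.moebius e : ℂ))]
  have key : ∑ i ∈ n.divisors, (ArithmeticFunction.moebius i : ℂ)
      = (1 : ArithmeticFunction ℂ) n := by
    rw [← coe_moebius_mul_coe_zeta (R := ℂ), coe_mul_zeta_apply]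
    simp only [intCoe_apply]
  rw [key, one_apply]
  split_ifs with h1
  · simp [h1]
  · simp

/-- The defect `h = g * (μ g̃)` measuring the failure of complete multiplicativity of `g`
(Tao 2016, proof of Prop. 2.2: "we can factor `g₁` as a Dirichlet convolution `g₁ = g̃₁ * h`").
[cite: TaoFMP2016, proof of Proposition 2.2] -/
noncomputable def cmDefect : ArithmeticFunction ℂ := g * cmLiftInv g

/-- **Twisted Möbius inversion**: `g = g̃ * h` ("we can factor `g₁` as a Dirichlet convolution
`g₁ = g̃₁ * h`"). [cite: TaoFMP2016, proof of Proposition 2.2] -/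
theorem cmLift_mul_cmDefect : cmLift g * cmDefect g = g := by
  rw [cmDefect, mul_left_comm, cmLift_mul_cmLiftInv, mul_one]

/-- `h` is multiplicative ("for a multiplicative function `h`").
[cite: TaoFMP2016, proof of Proposition 2.2] -/
theorem isMultiplicative_cmDefect (hg : g.IsMultiplicative) : (cmDefect g).IsMultiplicative :=
  hg.mul (isMultiplicative_cmLiftInv g)

/-- `h(p^j) = g(p^j) - g(p) g(p^{j-1})` for `j ≥ 1` (as printed).
[cite: TaoFMP2016, proof of Proposition 2.2] -/
theorem cmDefect_prime_pow {p : ℕ} (hp : p.Prime) {j : ℕ} (hj : 1 ≤ j) :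
    cmDefect g (p ^ j) = g (p ^ j) - g p * g (p ^ (j - 1)) := by
  rw [cmDefect, mul_apply, Nat.sum_divisorsAntidiagonal' (fun d e => g d * cmLiftInv g e),
    Nat.sum_divisors_prime_pow hp]
  obtain ⟨i, rfl⟩ : ∃ i, j = i + 1 := ⟨j - 1, by omega⟩
  rw [Finset.sum_range_succ', Finset.sum_range_succ']
  have h0 : ∀ x ∈ Finset.range i,
      g (p ^ (i + 1) / p ^ (x + 1 + 1)) * cmLiftInv g (p ^ (x + 1 + 1)) = 0 := by
    intro x _
    rw [cmLiftInv_apply, ArithmeticFunction.moebius_apply_prime_pow hp (by omega : x + 1 + 1 ≠ 0)]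
    simp
  have hdiv : p ^ (i + 1) / p = p ^ i := by
    rw [pow_succ, Nat.mul_div_cancel _ hp.pos]
  rw [Finset.sum_eq_zero h0, zero_add, pow_zero, Nat.div_one, pow_one, hdiv, cmLiftInv_apply,
    cmLiftInv_apply, ArithmeticFunction.moebius_apply_prime hp, cmLift_prime g hp,
    ArithmeticFunction.moebius_apply_one, cmLift_one]
  simp only [Nat.add_sub_cancel]
  push_cast
  ring

/-- `h(1) = 1`. [folklore] -/
@[simp] theorem cmDefect_one (hg : g.IsMultiplicative) : cmDefect g 1 = 1 :=
  (isMultiplicative_cmDefect g hg).1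

/-- `h(p) = 0`. [cite: TaoFMP2016, proof of Proposition 2.2] -/
theorem cmDefect_prime (hg : g.IsMultiplicative) {p : ℕ} (hp : p.Prime) : cmDefect g p = 0 := by
  have := cmDefect_prime_pow g hp (le_refl 1)
  rw [pow_one] at this
  rw [this, Nat.sub_self, pow_zero, hg.1, mul_one, sub_self]

/-- `|h(p^j)| ≤ 2` for `1`-bounded `g`. [cite: TaoFMP2016, proof of Proposition 2.2] -/
theorem norm_cmDefect_prime_pow_le (hb : ∀ n, ‖g n‖ ≤ 1) {p : ℕ} (hp : p.Prime) {j : ℕ}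
    (hj : 1 ≤ j) : ‖cmDefect g (p ^ j)‖ ≤ 2 := by
  rw [cmDefect_prime_pow g hp hj]
  refine (norm_sub_le _ _).trans ?_
  rw [norm_mul]
  have := mul_le_one₀ (hb p) (norm_nonneg _) (hb (p ^ (j - 1)))
  linarith [hb (p ^ j)]

/-- The crude bound `|h(d)| ≤ d` (the paper "crudely bound[s] `|h(d)|` by `A₀`" for `d ≤ A₀`).
[cite: TaoFMP2016, proof of Proposition 2.2] -/
theorem norm_cmDefect_le_self (hg : g.IsMultiplicative) (hb : ∀ n, ‖g n‖ ≤ 1) (d : ℕ) :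
    ‖cmDefect g d‖ ≤ d := by
  induction d using Nat.recOnPosPrimePosCoprime with
  | prime_pow p k hp hk =>
    refine (norm_cmDefect_prime_pow_le g hb hp hk).trans ?_
    calc (2 : ℝ) ≤ p := by exact_mod_cast hp.two_le
      _ = (p : ℝ) ^ 1 := (pow_one _).symm
      _ ≤ (p : ℝ) ^ k := pow_le_pow_right₀ (by exact_mod_cast hp.one_le) hk
      _ = ((p ^ k : ℕ) : ℝ) := by push_cast; rfl
  | zero => simp
  | one => simp [cmDefect_one g hg]
  | coprime m n hm hn hmn ihm ihn =>
    rw [(isMultiplicative_cmDefect g hg).map_mul_of_coprime hmn, norm_mul, Nat.cast_mul]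
    exact mul_le_mul ihm ihn (norm_nonneg _) (Nat.cast_nonneg m)

/-! ### The Euler product bound `∑_d |h(d)| d^{-2/3} = O(1)` -/

/-- The weight `F(d) = |h(d)| d^{-2/3}` summed in `∑_d |h(d)| d^{-2/3} = O(1)`.
[cite: TaoFMP2016, proof of Proposition 2.2] -/
noncomputable def defectWeight (d : ℕ) : ℝ := ‖cmDefect g d‖ * (d : ℝ) ^ (-(2 / 3 : ℝ))

/-- `F ≥ 0`. [folklore] -/
theorem defectWeight_nonneg (d : ℕ) : 0 ≤ defectWeight g d :=
  mul_nonneg (norm_nonneg _) (Real.rpow_nonneg (Nat.cast_nonneg d) _)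

/-- `F(1) = 1`. [folklore] -/
theorem defectWeight_one (hg : g.IsMultiplicative) : defectWeight g 1 = 1 := by
  simp [defectWeight, cmDefect_one g hg]

/-- `F` is multiplicative. [folklore] -/
theorem defectWeight_mul_of_coprime (hg : g.IsMultiplicative) {m n : ℕ} (hmn : m.Coprime n) :
    defectWeight g (m * n) = defectWeight g m * defectWeight g n := by
  unfold defectWeight
  rw [(isMultiplicative_cmDefect g hg).map_mul_of_coprime hmn, norm_mul, Nat.cast_mul,
    Real.mul_rpow (Nat.cast_nonneg m) (Nat.cast_nonneg n)]
  ring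

/-- `F(p) = 0`. [folklore] -/
theorem defectWeight_prime (hg : g.IsMultiplicative) {p : ℕ} (hp : p.Prime) :
    defectWeight g p = 0 := by
  simp [defectWeight, cmDefect_prime g hg hp]

/-- `F(p^j) ≤ 2 (p^{-2/3})^j` for all `j` (for `j = 0` the left side is `1`). [folklore] -/
theorem defectWeight_prime_pow_le (hg : g.IsMultiplicative) (hb : ∀ n, ‖g n‖ ≤ 1) {p : ℕ}
    (hp : p.Prime) (j : ℕ) :
    defectWeight g (p ^ j) ≤ 2 * ((p : ℝ) ^ (-(2 / 3 : ℝ))) ^ j := by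
  have hq : ((p ^ j : ℕ) : ℝ) ^ (-(2 / 3 : ℝ)) = ((p : ℝ) ^ (-(2 / 3 : ℝ))) ^ j := by
    rw [Nat.cast_pow, ← Real.rpow_natCast, ← Real.rpow_mul (Nat.cast_nonneg p),
      mul_comm, Real.rpow_mul (Nat.cast_nonneg p), Real.rpow_natCast]
  unfold defectWeight
  rw [hq]
  refine mul_le_mul_of_nonneg_right ?_ (pow_nonneg (Real.rpow_nonneg (Nat.cast_nonneg p) _) j)
  rcases Nat.eq_zero_or_pos j with rfl | hj
  · simp [cmDefect_one g hg]
  · exact norm_cmDefect_prime_pow_le g hb hp hj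

/-- `2^{-2/3} ≤ 7/10`. [folklore] -/
private theorem _root_.Literature.NumberTheory.Sieve.two_rpow_neg_two_thirds_le : (2 : ℝ) ^ (-(2 / 3 : ℝ)) ≤ 7 / 10 := by
  have h1 : (10 / 7 : ℝ) ≤ (2 : ℝ) ^ ((2 / 3 : ℝ)) := by
    refine le_of_pow_le_pow_left₀ (n := 3) (by norm_num) (Real.rpow_nonneg (by norm_num) _) ?_
    rw [← Real.rpow_natCast ((2 : ℝ) ^ ((2 / 3 : ℝ))) 3, ← Real.rpow_mul (by norm_num)]
    norm_num
  rw [Real.rpow_neg (by norm_num)]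
  rw [inv_le_comm₀ (Real.rpow_pos_of_pos (by norm_num) _) (by norm_num)]
  linarith

/-- For a prime `p`: `q = p^{-2/3}` satisfies `0 ≤ q ≤ 7/10` and `q² = p^{-4/3}`. [folklore] -/
private theorem prime_rpow_facts {p : ℕ} (hp : p.Prime) :
    0 ≤ (p : ℝ) ^ (-(2 / 3 : ℝ)) ∧ (p : ℝ) ^ (-(2 / 3 : ℝ)) ≤ 7 / 10 ∧
      ((p : ℝ) ^ (-(2 / 3 : ℝ))) ^ 2 = (p : ℝ) ^ (-(4 / 3 : ℝ)) := by
  refine ⟨Real.rpow_nonneg (Nat.cast_nonneg p) _, ?_, ?_⟩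
  · refine le_trans ?_ Literature.NumberTheory.Sieve.two_rpow_neg_two_thirds_le
    exact Real.rpow_le_rpow_of_nonpos (by norm_num) (by exact_mod_cast hp.two_le) (by norm_num)
  · rw [← Real.rpow_natCast, ← Real.rpow_mul (Nat.cast_nonneg p)]
    norm_num

/-- The local Euler factor: `∑_j F(p^j) ≤ 1 + 7 p^{-4/3}` (the `j = 1` term vanishes). [folklore] -/
theorem summable_defectWeight_prime_pow (hg : g.IsMultiplicative) (hb : ∀ n, ‖g n‖ ≤ 1)
    {p : ℕ} (hp : p.Prime) :
    Summable (fun j : ℕ => defectWeight g (p ^ j)) ∧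
      ∑' j : ℕ, defectWeight g (p ^ j) ≤ 1 + 7 * (p : ℝ) ^ (-(4 / 3 : ℝ)) := by
  obtain ⟨hq0, hq7, hq2⟩ := prime_rpow_facts hp
  set q : ℝ := (p : ℝ) ^ (-(2 / 3 : ℝ)) with hqdef
  have hq1 : q < 1 := by linarith
  have hgeom : Summable (fun j : ℕ => 2 * q ^ j) :=
    (summable_geometric_of_lt_one hq0 hq1).mul_left 2
  have hle : ∀ j, defectWeight g (p ^ j) ≤ 2 * q ^ j := defectWeight_prime_pow_le g hg hb hp
  have hsum : Summable (fun j : ℕ => defectWeight g (p ^ j)) :=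
    Summable.of_nonneg_of_le (fun j => defectWeight_nonneg g _) hle hgeom
  refine ⟨hsum, ?_⟩
  rw [hsum.tsum_eq_zero_add, pow_zero, defectWeight_one g hg,
    ((summable_nat_add_iff 1).mpr hsum).tsum_eq_zero_add, zero_add, pow_one,
    defectWeight_prime g hg hp, zero_add]
  have hle2 : ∀ j : ℕ, defectWeight g (p ^ (j + 1 + 1)) ≤ 2 * q ^ 2 * q ^ j := by
    intro j
    calc _ ≤ 2 * q ^ (j + 1 + 1) := hle _
      _ = 2 * q ^ 2 * q ^ j := by ring
  have hgeom2 : Summable (fun j : ℕ => 2 * q ^ 2 * q ^ j) :=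
    (summable_geometric_of_lt_one hq0 hq1).mul_left _
  have h3 : ∑' j : ℕ, defectWeight g (p ^ (j + 1 + 1)) ≤ 2 * q ^ 2 * (1 - q)⁻¹ := by
    calc _ ≤ ∑' j : ℕ, 2 * q ^ 2 * q ^ j :=
          ((summable_nat_add_iff 2).mpr hsum).tsum_le_tsum hle2 hgeom2
      _ = 2 * q ^ 2 * (1 - q)⁻¹ := by rw [tsum_mul_left, tsum_geometric_of_lt_one hq0 hq1]
  have h4 : (1 - q)⁻¹ ≤ 10 / 3 := by
    rw [inv_le_comm₀ (by linarith) (by norm_num)]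
    linarith
  have h5 : 2 * q ^ 2 * (1 - q)⁻¹ ≤ 7 * q ^ 2 := by nlinarith [sq_nonneg q]
  rw [← hq2]
  linarith

/-- The absolute constant `C = exp(7 ∑_n n^{-4/3})` bounding `∑_d |h(d)| d^{-2/3}` (the `O(1)` of
the paper, made explicit). [cite: TaoFMP2016, proof of Proposition 2.2] -/
noncomputable def cmDefectBound : ℝ := Real.exp (7 * ∑' n : ℕ, (n : ℝ) ^ (-(4 / 3 : ℝ)))

/-- **`∑_{d ≤ D} |h(d)| d^{-2/3} ≤ C`** uniformly in the `1`-bounded multiplicative `g` and in `D`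
(Tao 2016, proof of Prop. 2.2: "from taking Euler products one sees that
`∑_d |h(d)| / d^{2/3} = O(1)`"). [cite: TaoFMP2016, proof of Proposition 2.2] -/
theorem sum_defectWeight_le (hg : g.IsMultiplicative) (hb : ∀ n, ‖g n‖ ≤ 1) (D : ℕ) :
    ∑ d ∈ Icc 1 D, defectWeight g d ≤ cmDefectBound := by
  classical
  set N := D + 1 with hN
  have hF1 : defectWeight g 1 = 1 := defectWeight_one g hg
  have hmul : ∀ {m n : ℕ}, m.Coprime n →
      defectWeight g (m * n) = defectWeight g m * defectWeight g n :=
    fun hmn => defectWeight_mul_of_coprime g hg hmn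
  have hsumF : ∀ {p : ℕ}, p.Prime → Summable (fun j : ℕ => ‖defectWeight g (p ^ j)‖) := by
    intro p hp
    simpa only [Real.norm_of_nonneg (defectWeight_nonneg g _)] using
      (summable_defectWeight_prime_pow g hg hb hp).1
  obtain ⟨-, hhas⟩ :=
    EulerProduct.summable_and_hasSum_smoothNumbers_prod_primesBelow_tsum hF1 hmul hsumF N
  -- the finite sum is a partial sum of the sum over `N`-smooth numbers
  have h1 : ∑ d ∈ Icc 1 D, defectWeight g d
      ≤ ∏ p ∈ N.primesBelow, ∑' j : ℕ, defectWeight g (p ^ j) := by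
    have hsub : ∑ d ∈ Icc 1 D, defectWeight g d =
        ∑ m ∈ (Icc 1 D).subtype (· ∈ N.smoothNumbers), defectWeight g (m : ℕ) := by
      rw [Finset.sum_subtype_eq_sum_filter]
      refine (Finset.sum_congr ?_ fun _ _ => rfl)
      refine (Finset.filter_true_of_mem fun d hd => ?_).symm
      rw [Finset.mem_Icc] at hd
      exact Nat.mem_smoothNumbers_of_lt hd.1 (by omega)
    rw [hsub]
    exact sum_le_hasSum _ (fun m _ => defectWeight_nonneg g _) hhas
  refine h1.trans ?_
  -- bound each local factor by `1 + 7 p^{-4/3} ≤ exp(7 p^{-4/3})`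
  have h2 : ∏ p ∈ N.primesBelow, ∑' j : ℕ, defectWeight g (p ^ j)
      ≤ ∏ p ∈ N.primesBelow, Real.exp (7 * (p : ℝ) ^ (-(4 / 3 : ℝ))) := by
    refine Finset.prod_le_prod (fun p _ => tsum_nonneg fun j => defectWeight_nonneg g _)
      fun p hp => ?_
    have hp' : p.Prime := (Nat.mem_primesBelow.mp hp).2
    refine (summable_defectWeight_prime_pow g hg hb hp').2.trans ?_
    linarith [Real.add_one_le_exp (7 * (p : ℝ) ^ (-(4 / 3 : ℝ)))]
  refine h2.trans ?_
  rw [← Real.exp_sum, cmDefectBound, Real.exp_le_exp, ← Finset.mul_sum]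
  refine mul_le_mul_of_nonneg_left ?_ (by norm_num)
  have hs : Summable (fun n : ℕ => (n : ℝ) ^ (-(4 / 3 : ℝ))) :=
    Real.summable_nat_rpow.mpr (by norm_num)
  exact hs.sum_le_tsum _ (fun n _ => Real.rpow_nonneg (Nat.cast_nonneg n) _)


end CM

/-! ## Elementary lemmas (namespace `Literature.Tao2016`) -/

namespace Tao2016

/-! ### Harmonic-type bounds -/

/-- `∑_{⌊P⌋ < m ≤ ⌊Q⌋} 1/m ≤ 1 + log (Q/P)` for `0 < P ≤ Q`. [folklore] -/
theorem sum_inv_Ioc_floor_le {P Q : ℝ} (hP : 0 < P) (hPQ : P ≤ Q) :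
    ∑ m ∈ Ioc ⌊P⌋₊ ⌊Q⌋₊, (m : ℝ)⁻¹ ≤ 1 + Real.log (Q / P) := by
  have hQ : 0 < Q := hP.trans_le hPQ
  rcases lt_or_ge Q 1 with hQ1 | hQ1
  · have : ⌊Q⌋₊ = 0 := Nat.floor_eq_zero.mpr hQ1
    rw [this]
    have hempty : Ioc ⌊P⌋₊ 0 = ∅ := by
      ext m; simp
    rw [hempty, Finset.sum_empty]
    have : 0 ≤ Real.log (Q / P) := Real.log_nonneg ((one_le_div hP).mpr hPQ)
    linarith
  · have hsplit : ∑ m ∈ Ioc ⌊P⌋₊ ⌊Q⌋₊, (m : ℝ)⁻¹ =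
        ∑ m ∈ Icc 1 ⌊Q⌋₊, (m : ℝ)⁻¹ - ∑ m ∈ Icc 1 ⌊P⌋₊, (m : ℝ)⁻¹ := by
      have hPQ' : ⌊P⌋₊ ≤ ⌊Q⌋₊ := Nat.floor_le_floor hPQ
      have h1 : Icc 1 ⌊Q⌋₊ = Ioc 0 ⌊Q⌋₊ := rfl
      have h2 : Icc 1 ⌊P⌋₊ = Ioc 0 ⌊P⌋₊ := rfl
      rw [h1, h2, ← Finset.sum_Ioc_consecutive _ (Nat.zero_le _) hPQ']
      ring
    have hharmQ : ∑ m ∈ Icc 1 ⌊Q⌋₊, (m : ℝ)⁻¹ ≤ 1 + Real.log Q := by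
      have := harmonic_floor_le_one_add_log Q hQ1
      simpa only [harmonic_eq_sum_Icc, Rat.cast_sum, Rat.cast_inv, Rat.cast_natCast] using this
    have hharmP : Real.log P ≤ ∑ m ∈ Icc 1 ⌊P⌋₊, (m : ℝ)⁻¹ := by
      have h1 : Real.log P ≤ Real.log (⌊P⌋₊ + 1 : ℕ) := by
        refine Real.log_le_log hP ?_
        push_cast
        exact (Nat.lt_floor_add_one P).le
      have h2 := log_add_one_le_harmonic ⌊P⌋₊
      have h3 : ((harmonic ⌊P⌋₊ : ℚ) : ℝ) = ∑ m ∈ Icc 1 ⌊P⌋₊, (m : ℝ)⁻¹ := by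
        simp only [harmonic_eq_sum_Icc, Rat.cast_sum, Rat.cast_inv, Rat.cast_natCast]
      push_cast at h1 h2
      linarith
    rw [hsplit, Real.log_div hQ.ne' hP.ne']
    linarith

/-- `∑_{m ∈ Ioc a b} 1/m² ≤ 2`. [folklore] -/
theorem sum_inv_sq_Ioc_le_two (a b : ℕ) : ∑ m ∈ Ioc a b, ((m : ℝ) ^ 2)⁻¹ ≤ 2 := by
  have h := sum_Ioo_inv_sq_le (α := ℝ) 0 (b + 1)
  push_cast at h
  norm_num at h
  calc ∑ m ∈ Ioc a b, ((m : ℝ) ^ 2)⁻¹ ≤ ∑ m ∈ Ioo 0 (b + 1), ((m : ℝ) ^ 2)⁻¹ := by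
        refine Finset.sum_le_sum_of_subset_of_nonneg (fun m hm => ?_) fun m _ _ => by positivity
        rw [Finset.mem_Ioc] at hm
        rw [Finset.mem_Ioo]
        omega
    _ ≤ 2 := h

/-- A `1`-bounded numerator over `n : ℕ` has norm at most `1/n` (also for `n = 0`, where both
sides vanish). [folklore] -/
theorem norm_div_natCast_le {z : ℂ} (hz : ‖z‖ ≤ 1) (n : ℕ) : ‖z / (n : ℂ)‖ ≤ (n : ℝ)⁻¹ := by
  rw [norm_div, Complex.norm_natCast, ← one_div]
  rcases Nat.eq_zero_or_pos n with rfl | hn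
  · simp
  · exact div_le_div_of_nonneg_right hz (Nat.cast_nonneg n)

/-- … and hence norm at most `1`. [folklore] -/
theorem norm_div_natCast_le_one {z : ℂ} (hz : ‖z‖ ≤ 1) (n : ℕ) : ‖z / (n : ℂ)‖ ≤ 1 := by
  refine (norm_div_natCast_le hz n).trans ?_
  rcases Nat.eq_zero_or_pos n with rfl | hn
  · simp
  · exact inv_le_one_of_one_le₀ (by exact_mod_cast hn)

/-! ### Divisor sums over a fixed range -/

/-- For `1 ≤ m ≤ D`, a sum over the divisors of `m` is a sum over `d ∈ [1, D]` with the
indicator of `d ∣ m`. [folklore] -/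
theorem sum_divisors_eq_sum_Icc_ite {M : Type*} [AddCommMonoid M] (F : ℕ → M) {m D : ℕ}
    (hm : m ≠ 0) (hmD : m ≤ D) :
    ∑ d ∈ m.divisors, F d = ∑ d ∈ Icc 1 D, if d ∣ m then F d else 0 := by
  rw [← Finset.sum_filter]
  refine Finset.sum_congr ?_ fun _ _ => rfl
  ext d
  simp only [Nat.mem_divisors, Finset.mem_filter, Finset.mem_Icc]
  constructor
  · rintro ⟨hd, -⟩
    exact ⟨⟨Nat.pos_of_dvd_of_pos hd (Nat.pos_of_ne_zero hm),
      (Nat.le_of_dvd (Nat.pos_of_ne_zero hm) hd).trans hmD⟩, hd⟩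
  · rintro ⟨-, hd⟩
    exact ⟨hd, hm⟩

/-! ### Residue classes -/

/-- `d ∣ a n + b` only depends on `n mod d`. [folklore] -/
theorem dvd_linear_iff_dvd_linear_mod (a b n d : ℕ) : d ∣ a * n + b ↔ d ∣ a * (n % d) + b :=
  ((((Nat.mod_modEq n d).mul_left a).add_right b).dvd_iff dvd_rfl).symm

/-- Splitting a sum over `{n ∈ s : d ∣ a n + b}` according to the residue `r = n mod d`; only
residues with `d ∣ a r + b` contribute. [folklore] -/
theorem sum_filter_dvd_eq_sum_residues {M : Type*} [AddCommMonoid M] (F : ℕ → M) {d : ℕ}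
    (hd : 0 < d) (a b : ℕ) (s : Finset ℕ) :
    ∑ n ∈ s.filter (fun n => d ∣ a * n + b), F n
      = ∑ r ∈ (range d).filter (fun r => d ∣ a * r + b),
          ∑ n ∈ s.filter (fun n => n % d = r), F n := by
  rw [Finset.sum_filter (s := range d),
    ← Finset.sum_fiberwise_of_maps_to (g := fun n => n % d) (t := range d)
      (fun n _ => mem_range.mpr (Nat.mod_lt n hd))]
  refine Finset.sum_congr rfl fun r _ => ?_
  split_ifs with hdiv
  · refine Finset.sum_congr ?_ fun _ _ => rfl
    ext n
    simp only [Finset.mem_filter]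
    constructor
    · rintro ⟨⟨hn, -⟩, hr⟩
      exact ⟨hn, hr⟩
    · rintro ⟨hn, hr⟩
      refine ⟨⟨hn, ?_⟩, hr⟩
      rw [dvd_linear_iff_dvd_linear_mod, hr]
      exact hdiv
  · refine Finset.sum_eq_zero fun n hn => ?_
    exfalso
    simp only [Finset.mem_filter] at hn
    obtain ⟨⟨-, hdn⟩, hr⟩ := hn
    rw [dvd_linear_iff_dvd_linear_mod, hr] at hdn
    exact hdiv hdn

/-- Re-indexing the residue class `n ≡ r (mod d)` in `(L, U]` by `n = d n' + r`:
`n'` ranges over `{n' ≤ (U - r)/d : L < d n' + r}`. [folklore] -/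
theorem sum_filter_mod_eq_sum {M : Type*} [AddCommMonoid M] (F : ℕ → M) {d r L U : ℕ}
    (hd : 0 < d) (hr : r < d) (hrU : r ≤ U) :
    ∑ n ∈ (Ioc L U).filter (fun n => n % d = r), F n
      = ∑ n' ∈ (Iic ((U - r) / d)).filter (fun n' => L < d * n' + r), F (d * n' + r) := by
  have hinj : Set.InjOn (fun n' => d * n' + r)
      ((Iic ((U - r) / d)).filter (fun n' => L < d * n' + r) : Set ℕ) := by
    intro x _ y _ h
    exact Nat.eq_of_mul_eq_mul_left hd (by simpa using h)
  rw [← Finset.sum_image hinj]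
  refine Finset.sum_congr ?_ fun _ _ => rfl
  ext n
  simp only [Finset.mem_filter, Finset.mem_Ioc, Finset.mem_image, Finset.mem_Iic]
  constructor
  · rintro ⟨⟨hLn, hnU⟩, hmod⟩
    have hdecomp : d * (n / d) + r = n := by rw [← hmod]; exact Nat.div_add_mod n d
    refine ⟨n / d, ⟨?_, by omega⟩, hdecomp⟩
    rw [Nat.le_div_iff_mul_le hd, mul_comm]
    omega
  · rintro ⟨n', ⟨hn'U, hLn'⟩, rfl⟩
    have h1 : n' * d ≤ U - r := (Nat.le_div_iff_mul_le hd).mp hn'U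
    rw [mul_comm] at h1
    refine ⟨⟨hLn', by omega⟩, ?_⟩
    rw [Nat.mul_add_mod, Nat.mod_eq_of_lt hr]

/-- The index set `{n' ≤ N : L < d n' + r}` is `(⌊(L - r)/d⌋, N]` together with `n' = 0` when
`L < r`: the corresponding sum identity. [folklore] -/
theorem sum_filter_Iic_eq {M : Type*} [AddCommMonoid M] (Ψ : ℕ → M) {d r L : ℕ} (hd : 0 < d)
    (N : ℕ) :
    ∑ n' ∈ (Iic N).filter (fun n' => L < d * n' + r), Ψ n'
      = (if L < r then Ψ 0 else 0) + ∑ n' ∈ Ioc ((L - r) / d) N, Ψ n' := by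
  have hIic : Iic N = cons 0 (Ioc 0 N) (by simp) := by
    rw [← Finset.Icc_eq_cons_Ioc (Nat.zero_le N)]
    rfl
  have hfilt : (Ioc 0 N).filter (fun n' => L < d * n' + r) = Ioc ((L - r) / d) N := by
    ext n'
    simp only [Finset.mem_filter, Finset.mem_Ioc, Nat.div_lt_iff_lt_mul hd]
    constructor
    · rintro ⟨⟨h0, hN⟩, hL⟩
      refine ⟨?_, hN⟩
      rw [mul_comm]
      have := Nat.mul_pos hd h0
      omega
    · rintro ⟨hL, hN⟩
      rw [mul_comm] at hL
      have : 0 < n' := by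
        rcases Nat.eq_zero_or_pos n' with rfl | h
        · simp at hL
        · exact h
      exact ⟨⟨this, hN⟩, by omega⟩
  rw [hIic, Finset.filter_cons, ← hfilt]
  simp only [mul_zero, zero_add]
  split_ifs with h
  · rw [Finset.sum_cons]
  · rw [zero_add]

/-! ## Engine part B: the change of variables `n = d n' + r` and the oracle -/

/-- `z / n = z · (1/n : ℝ)` as a real scalar. [folklore] -/
theorem div_natCast_eq_mul_ofReal (z : ℂ) (n : ℕ) :
    z / (n : ℂ) = z * (((n : ℝ)⁻¹ : ℝ) : ℂ) := by
  rw [div_eq_mul_inv, Complex.ofReal_inv, Complex.ofReal_natCast]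

/-- `‖∑ X(n) w(n)‖ ≤ ∑ |w(n)|` for `1`-bounded `X` and real weights `w`. [folklore] -/
theorem norm_sum_mul_ofReal_le (s : Finset ℕ) {X : ℕ → ℂ} (hX : ∀ n, ‖X n‖ ≤ 1) (w : ℕ → ℝ) :
    ‖∑ n ∈ s, X n * (w n : ℂ)‖ ≤ ∑ n ∈ s, |w n| := by
  refine (norm_sum_le _ _).trans (Finset.sum_le_sum fun n _ => ?_)
  rw [norm_mul, Complex.norm_real, Real.norm_eq_abs]
  exact mul_le_of_le_one_left (abs_nonneg _) (hX n)

/-- `‖∑ X(n) w₁(n) - ∑ X(n) w₂(n)‖ ≤ ∑ |w₁(n) - w₂(n)|` for `1`-bounded `X`. [folklore] -/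
theorem norm_sum_mul_ofReal_sub_le (s : Finset ℕ) {X : ℕ → ℂ} (hX : ∀ n, ‖X n‖ ≤ 1)
    (w₁ w₂ : ℕ → ℝ) :
    ‖∑ n ∈ s, X n * (w₁ n : ℂ) - ∑ n ∈ s, X n * (w₂ n : ℂ)‖ ≤ ∑ n ∈ s, |w₁ n - w₂ n| := by
  rw [← Finset.sum_sub_distrib]
  have : ∀ n ∈ s, X n * (w₁ n : ℂ) - X n * (w₂ n : ℂ) = X n * ((w₁ n - w₂ n : ℝ) : ℂ) := by
    intro n _
    push_cast
    ring
  rw [Finset.sum_congr rfl this]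
  exact norm_sum_mul_ofReal_le s hX _

/-- `|1/(d n + r) - 1/(d n)| ≤ 1/n²` for `n, d ≥ 1`, `0 ≤ r < d`. [folklore] -/
theorem abs_inv_linear_sub_inv_le {d r n : ℕ} (hd : 0 < d) (hr : r < d) (hn : 0 < n) :
    |((d * n + r : ℕ) : ℝ)⁻¹ - ((d : ℝ) * n)⁻¹| ≤ ((n : ℝ) ^ 2)⁻¹ := by
  have hdR : (1 : ℝ) ≤ d := by exact_mod_cast hd
  have hnR : (1 : ℝ) ≤ n := by exact_mod_cast hn
  have hdn : (0 : ℝ) < (d : ℝ) * n := by positivity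
  have h1 : (d : ℝ) * n ≤ ((d * n + r : ℕ) : ℝ) := by
    push_cast; linarith [(Nat.cast_nonneg r : (0:ℝ) ≤ r)]
  have h2 : ((d * n + r : ℕ) : ℝ) ≤ (d : ℝ) * (n + 1) := by
    have : (r : ℝ) ≤ d := by exact_mod_cast hr.le
    push_cast; linarith
  have hv : ((d * n + r : ℕ) : ℝ)⁻¹ ≤ ((d : ℝ) * n)⁻¹ := inv_anti₀ hdn h1
  have hlo : ((d : ℝ) * (n + 1))⁻¹ ≤ ((d * n + r : ℕ) : ℝ)⁻¹ := inv_anti₀ (hdn.trans_le h1) h2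
  rw [abs_sub_comm, abs_of_nonneg (sub_nonneg.mpr hv)]
  have hd0 : (d : ℝ) ≠ 0 := by positivity
  have hn0 : (n : ℝ) ≠ 0 := by positivity
  have hn1 : (n : ℝ) + 1 ≠ 0 := by positivity
  calc ((d : ℝ) * n)⁻¹ - ((d * n + r : ℕ) : ℝ)⁻¹
        ≤ ((d : ℝ) * n)⁻¹ - ((d : ℝ) * (n + 1))⁻¹ := by linarith
    _ = ((d : ℝ) * (n * (n + 1)))⁻¹ := by field_simp; ring
    _ ≤ ((n : ℝ) ^ 2)⁻¹ := by
        refine inv_anti₀ (by positivity) ?_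
        nlinarith [mul_nonneg (sub_nonneg.mpr hdR) (mul_nonneg (by positivity : (0:ℝ) ≤ n)
          (by positivity : (0:ℝ) ≤ n + 1))]

/-- **The change of variables `n = d n' + r` in a residue class** (Tao 2016, proof of Prop. 2.2:
"making an appropriate change of variables"): for `Y(d n' + r) = X(n')` with `X` `1`-bounded,
`‖∑_{L < n ≤ U, n ≡ r (d)} Y(n)/n‖ ≤ 3 + ‖∑_{(L-r)/d < n' ≤ (U-r)/d} X(n')/n'‖ / d`
(the `n' = 0` term and the replacement of `1/(dn'+r)` by `1/(dn')` cost at most `1 + 2`).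
[cite: TaoFMP2016, proof of Proposition 2.2] -/
theorem residueClass_sum_bound {d r L U : ℕ} (hd : 0 < d) (hr : r < d) (hrU : r ≤ U)
    (Y X : ℕ → ℂ) (hYX : ∀ n', Y (d * n' + r) = X n') (hX : ∀ n', ‖X n'‖ ≤ 1) :
    ‖∑ n ∈ (Ioc L U).filter (fun n => n % d = r), Y n / (n : ℂ)‖
      ≤ 3 + ‖∑ n' ∈ Ioc ((L - r) / d) ((U - r) / d), X n' / (n' : ℂ)‖ / d := by
  rw [sum_filter_mod_eq_sum (fun n => Y n / (n : ℂ)) hd hr hrU, sum_filter_Iic_eq _ hd]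
  set P := (L - r) / d
  set Q := (U - r) / d
  -- the `n' = 0` term
  have hYr : ‖Y (d * 0 + r)‖ ≤ 1 := by rw [hYX]; exact hX 0
  have h0 : ‖(if L < r then Y (d * 0 + r) / ((d * 0 + r : ℕ) : ℂ) else 0)‖ ≤ 1 := by
    split_ifs
    · exact norm_div_natCast_le_one hYr _
    · simp
  -- the main term, with weights `1/(dn'+r)` and `1/(dn')`
  have hmain : ∑ n' ∈ Ioc P Q, Y (d * n' + r) / ((d * n' + r : ℕ) : ℂ)
      = ∑ n' ∈ Ioc P Q, X n' * ((((d * n' + r : ℕ) : ℝ)⁻¹ : ℝ) : ℂ) := by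
    refine Finset.sum_congr rfl fun n' _ => ?_
    rw [hYX, div_natCast_eq_mul_ofReal]
  have hcmp : ‖∑ n' ∈ Ioc P Q, X n' * ((((d * n' + r : ℕ) : ℝ)⁻¹ : ℝ) : ℂ)
      - ∑ n' ∈ Ioc P Q, X n' * ((((d : ℝ) * n')⁻¹ : ℝ) : ℂ)‖ ≤ 2 := by
    refine (norm_sum_mul_ofReal_sub_le _ hX _ _).trans ?_
    refine le_trans (Finset.sum_le_sum fun n' hn' => abs_inv_linear_sub_inv_le hd hr ?_)
      (sum_inv_sq_Ioc_le_two P Q)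
    exact Nat.zero_lt_of_lt (Finset.mem_Ioc.mp hn').1
  have hscale : ∑ n' ∈ Ioc P Q, X n' * ((((d : ℝ) * n')⁻¹ : ℝ) : ℂ)
      = (∑ n' ∈ Ioc P Q, X n' / (n' : ℂ)) * (d : ℂ)⁻¹ := by
    rw [Finset.sum_mul]
    refine Finset.sum_congr rfl fun n' _ => ?_
    push_cast
    rw [mul_inv, div_eq_mul_inv]
    ring
  have hnorm2 : ‖(∑ n' ∈ Ioc P Q, X n' / (n' : ℂ)) * (d : ℂ)⁻¹‖
      = ‖∑ n' ∈ Ioc P Q, X n' / (n' : ℂ)‖ / d := by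
    rw [norm_mul, norm_inv, Complex.norm_natCast, div_eq_mul_inv]
  have hmainb : ‖∑ n' ∈ Ioc P Q, Y (d * n' + r) / ((d * n' + r : ℕ) : ℂ)‖
      ≤ 2 + ‖∑ n' ∈ Ioc P Q, X n' / (n' : ℂ)‖ / d := by
    rw [hmain, ← hnorm2, ← hscale]
    exact (norm_le_norm_sub_add _ _).trans (add_le_add hcmp le_rfl)
  calc _ ≤ _ := norm_add_le _ _
    _ ≤ 1 + (2 + ‖∑ n' ∈ Ioc P Q, X n' / (n' : ℂ)‖ / d) := add_le_add h0 hmainb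
    _ = _ := by ring

/-- **From the log-averaged hypothesis to all tails** (Tao 2016, proof of Prop. 2.2, "using the
hypothesis that Theorem 1.3 holds for completely multiplicative `g₁`"): if
`‖∑_{x'/ω' < n ≤ x'} X(n)/n‖ ≤ ε' log ω'` for all `A' ≤ ω' ≤ x'` (`A' ≥ 1`), then for every
`P` with `(P + 2) A' ≤ x'`, `‖∑_{P < n ≤ x'} X(n)/n‖ ≤ 1 + ε' log (x' / max(1, P))`
(take `ω' = x'/P`, or `ω' = x'` and discard the term `n = 1` when `P = 0`).
[cite: TaoFMP2016, proof of Proposition 2.2] -/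
theorem tail_bound_of_oracle {X : ℕ → ℂ} (hX : ∀ n, ‖X n‖ ≤ 1) {x' A' ε' : ℝ} (hA' : 1 ≤ A')
    (horacle : ∀ ω' : ℝ, A' ≤ ω' → ω' ≤ x' →
      ‖∑ n ∈ Ioc ⌊x' / ω'⌋₊ ⌊x'⌋₊, X n / (n : ℂ)‖ ≤ ε' * Real.log ω')
    (P : ℕ) (hP : ((P : ℝ) + 2) * A' ≤ x') :
    ‖∑ n ∈ Ioc P ⌊x'⌋₊, X n / (n : ℂ)‖ ≤ 1 + ε' * Real.log (x' / max 1 (P : ℝ)) := by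
  have hP0 : (0 : ℝ) ≤ P := Nat.cast_nonneg P
  have hx'2 : 2 ≤ x' := by nlinarith
  have hx'pos : 0 < x' := by linarith
  have key : ∀ P' : ℕ, 1 ≤ P' → (P' : ℝ) * A' ≤ x' →
      ‖∑ n ∈ Ioc P' ⌊x'⌋₊, X n / (n : ℂ)‖ ≤ ε' * Real.log (x' / P') := by
    intro P' hP'1 hP'A
    have hP'pos : (0 : ℝ) < P' := by exact_mod_cast hP'1
    have h1 : A' ≤ x' / P' := by
      rw [le_div_iff₀ hP'pos]
      linarith [mul_comm (P' : ℝ) A']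
    have h2 : x' / P' ≤ x' := div_le_self hx'pos.le (by exact_mod_cast hP'1)
    have h3 : ⌊x' / (x' / P')⌋₊ = P' := by
      rw [div_div_cancel₀ hx'pos.ne', Nat.floor_natCast]
    have := horacle (x' / P') h1 h2
    rwa [h3] at this
  rcases Nat.eq_zero_or_pos P with rfl | hPpos
  · have hP2 : 2 * A' ≤ x' := by simpa using hP
    have hQ : 1 ≤ ⌊x'⌋₊ := Nat.le_floor (by push_cast; linarith)
    rw [← Finset.sum_Ioc_consecutive _ (Nat.zero_le 1) hQ]
    have hI : Ioc 0 1 = {1} := rfl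
    rw [hI, Finset.sum_singleton, Nat.cast_zero, max_eq_left (zero_le_one : (0:ℝ) ≤ 1), div_one]
    have hk := key 1 le_rfl (by rw [Nat.cast_one]; linarith)
    rw [Nat.cast_one, div_one] at hk
    calc _ ≤ ‖X 1 / ((1 : ℕ) : ℂ)‖ + ‖∑ n ∈ Ioc 1 ⌊x'⌋₊, X n / (n : ℂ)‖ := norm_add_le _ _
      _ ≤ 1 + ε' * Real.log x' := add_le_add (norm_div_natCast_le_one (hX 1) 1) hk
  · have hk := key P hPpos (by nlinarith)
    rw [max_eq_right (by exact_mod_cast hPpos : (1 : ℝ) ≤ P)]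
    linarith [norm_nonneg (∑ n ∈ Ioc P ⌊x'⌋₊, X n / (n : ℂ))]

/-- The elementary inequality behind `x'/max(1,P) ≤ 4ω`: `L + 1 < 4 d max(1, (L-r)/d)` for
`r < d`. [folklore] -/
theorem succ_lt_four_mul_max {d r : ℕ} (hd : 0 < d) (hr : r < d) (L : ℕ) :
    L + 1 < 4 * d * max 1 ((L - r) / d) := by
  have h1 : L - r < d * ((L - r) / d + 1) := Nat.lt_mul_div_succ (L - r) hd
  have h2 : L ≤ (L - r) + r := le_tsub_add
  have h3 : (L - r) / d + 1 ≤ 2 * max 1 ((L - r) / d) := by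
    rcases Nat.eq_zero_or_pos ((L - r) / d) with h | h
    · rw [h]; simp
    · rw [max_eq_right h]; omega
  calc L + 1 ≤ (L - r) + r + 1 := by omega
    _ < d * ((L - r) / d + 1) + d := by omega
    _ ≤ d * (2 * max 1 ((L - r) / d)) + d * max 1 ((L - r) / d) := by
        refine add_le_add (Nat.mul_le_mul_left d h3) ?_
        exact le_mul_of_one_le_right (Nat.zero_le _) (le_max_left _ _)
    _ ≤ 4 * d * max 1 ((L - r) / d) := by nlinarith [le_max_left 1 ((L - r) / d)]

/-- `⌊(N + 1/2)/d⌋ = N / d` for naturals `N`, `d ≥ 1`. [folklore] -/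
theorem floor_add_half_div {N d : ℕ} (hd : 0 < d) : ⌊((N : ℝ) + 1 / 2) / d⌋₊ = N / d := by
  have hdpos : (0 : ℝ) < d := by exact_mod_cast hd
  rw [Nat.floor_eq_iff (by positivity)]
  constructor
  · calc ((N / d : ℕ) : ℝ) ≤ (N : ℝ) / d := Nat.cast_div_le
      _ ≤ ((N : ℝ) + 1 / 2) / d := by gcongr; linarith
  · have h := Nat.lt_mul_div_succ N hd
    have h' : (N : ℝ) + 1 ≤ (d : ℝ) * ((N / d : ℕ) + 1) := by exact_mod_cast Nat.succ_le_of_lt h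
    rw [div_lt_iff₀ hdpos]
    nlinarith

/-- `(p + b)/(q + b) ≤ 1 + p/q` for `p, b ≥ 0`, `q > 0`. [folklore] -/
theorem div_add_le_one_add_div {p q b : ℝ} (hp : 0 ≤ p) (hq : 0 < q) (hb : 0 ≤ b) :
    (p + b) / (q + b) ≤ 1 + p / q := by
  rw [div_le_iff₀ (by positivity)]
  have : (1 + p / q) * (q + b) = q + b + p + p / q * b := by field_simp; ring
  rw [this]
  nlinarith [div_nonneg hp hq.le]

/-- **The terms with `d` large** (Tao 2016, proof of Prop. 2.2: "we can use the triangle inequality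
to bound [the inner sum] by `O(log ω / d)`"): for `d > 2b`, `a ≥ 1` and `L < U`,
`∑_{L < n ≤ U, d ∣ an+b} 1/n ≤ (2a/d) (1 + log (2a (1 + U/(L+1))))`
(substitute `m = (an+b)/d`, so that `1/n ≤ 2a/(dm)` and `m` runs over an interval).
[cite: TaoFMP2016, proof of Proposition 2.2] -/
theorem sum_inv_filter_dvd_le {a b d L U : ℕ} (ha : 1 ≤ a) (hbd : 2 * b < d) (hLU : L < U) :
    ∑ n ∈ (Ioc L U).filter (fun n => d ∣ a * n + b), (n : ℝ)⁻¹
      ≤ 2 * a / d * (1 + Real.log (2 * a * (1 + U / (L + 1)))) := by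
  have hd : 0 < d := by omega
  have hdR : (0 : ℝ) < d := by exact_mod_cast hd
  have haR : (1 : ℝ) ≤ a := by exact_mod_cast ha
  set S := (Ioc L U).filter (fun n => d ∣ a * n + b) with hS
  -- pointwise bound `1/n ≤ (2a/d) / m`, `m = (an+b)/d`
  have hpt : ∀ n ∈ S, (n : ℝ)⁻¹ ≤ 2 * a / d * (((a * n + b) / d : ℕ) : ℝ)⁻¹ := by
    intro n hn
    obtain ⟨hn, hdvd⟩ := Finset.mem_filter.mp hn
    have hn1 : 1 ≤ n := (Finset.mem_Ioc.mp hn).1.trans_le' (Nat.zero_le _) |> Nat.succ_le_of_lt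
    have hm : d * ((a * n + b) / d) = a * n + b := Nat.mul_div_cancel' hdvd
    have hle : d ≤ a * n + b := Nat.le_of_dvd (by positivity) hdvd
    have hbn : b ≤ a * n := by omega
    have hm1 : 1 ≤ (a * n + b) / d := Nat.div_pos hle hd
    have hmR : (0 : ℝ) < (((a * n + b) / d : ℕ) : ℝ) := by exact_mod_cast hm1
    have hnR : (0 : ℝ) < n := by exact_mod_cast hn1
    have hmR' : (d : ℝ) * (((a * n + b) / d : ℕ) : ℝ) = a * n + b := by exact_mod_cast hm
    have hd0 : (d : ℝ) ≠ 0 := hdR.ne'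
    have hm0 : (((a * n + b) / d : ℕ) : ℝ) ≠ 0 := hmR.ne'
    have goal_eq : (2 : ℝ) * a / d * (((a * n + b) / d : ℕ) : ℝ)⁻¹ = 2 * a / (a * n + b) := by
      rw [← hmR']
      field_simp
    rw [goal_eq, le_div_iff₀ (by positivity), inv_mul_le_iff₀ hnR]
    have : (b : ℝ) ≤ a * n := by exact_mod_cast hbn
    linarith
  -- injectivity of `n ↦ (an+b)/d` on `S`
  have hinj : Set.InjOn (fun n => (a * n + b) / d) S := by
    intro n hn n' hn' h
    have h1 := Nat.div_mul_cancel (Finset.mem_filter.mp hn).2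
    have h2 := Nat.div_mul_cancel (Finset.mem_filter.mp hn').2
    have h3 : (a * n + b) / d = (a * n' + b) / d := h
    have : a * n + b = a * n' + b := by rw [← h1, ← h2, h3]
    exact Nat.eq_of_mul_eq_mul_left ha (by omega)
  -- the image lies in an interval
  have himage : S.image (fun n => (a * n + b) / d)
      ⊆ Ioc ⌊(((a * L + b : ℕ) : ℝ) + 1 / 2) / d⌋₊ ⌊((a * U + b : ℕ) : ℝ) / d⌋₊ := by
    rw [floor_add_half_div hd, Nat.floor_div_eq_div]
    intro m hm
    rw [Finset.mem_image] at hm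
    obtain ⟨n, hn, rfl⟩ := hm
    obtain ⟨hn, hdvd⟩ := Finset.mem_filter.mp hn
    rw [Finset.mem_Ioc] at hn ⊢
    constructor
    · by_contra hcon
      push Not at hcon
      have h3 : d * ((a * n + b) / d) = a * n + b := Nat.mul_div_cancel' hdvd
      have h4 : d * ((a * L + b) / d) ≤ a * L + b := Nat.mul_div_le _ _
      have h5 := Nat.mul_le_mul_left d hcon
      have h6 : a * L < a * n := Nat.mul_lt_mul_of_pos_left hn.1 ha
      omega
    · exact Nat.div_le_div_right (by nlinarith [hn.2])
  -- the real endpoints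
  set Pr : ℝ := (((a * L + b : ℕ) : ℝ) + 1 / 2) / d with hPr
  set Qr : ℝ := ((a * U + b : ℕ) : ℝ) / d with hQr
  have hPpos : 0 < Pr := by positivity
  have hLU' : a * L + 1 ≤ a * U := by nlinarith
  have hPQ : Pr ≤ Qr := by
    rw [hPr, hQr]
    refine div_le_div_of_nonneg_right ?_ hdR.le
    have : ((a * L + 1 : ℕ) : ℝ) ≤ ((a * U : ℕ) : ℝ) := by exact_mod_cast hLU'
    push_cast at this ⊢
    linarith
  have hratio : Qr / Pr ≤ 2 * a * (1 + U / (L + 1)) := by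
    rw [hPr, hQr, div_div_div_cancel_right₀ hdR.ne']
    push_cast
    have hq : (0 : ℝ) < a * L + 1 / 2 := by positivity
    calc ((a : ℝ) * U + b) / ((a : ℝ) * L + b + 1 / 2)
          = ((a : ℝ) * U + b) / (((a : ℝ) * L + 1 / 2) + b) := by ring_nf
      _ ≤ 1 + (a : ℝ) * U / ((a : ℝ) * L + 1 / 2) :=
          div_add_le_one_add_div (by positivity) hq (Nat.cast_nonneg b)
      _ ≤ 1 + 2 * a * (U / (L + 1)) := by
          have hL1 : (0 : ℝ) < L + 1 := by positivity
          have hU : (0 : ℝ) ≤ U := Nat.cast_nonneg U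
          have hcoef : (a : ℝ) * (L + 1) ≤ 2 * a * ((a : ℝ) * L + 1 / 2) := by
            nlinarith [mul_nonneg (sub_nonneg.mpr haR) (Nat.cast_nonneg L),
              mul_nonneg (mul_nonneg (Nat.cast_nonneg a) (sub_nonneg.mpr haR)) (Nat.cast_nonneg L)]
          have : (a : ℝ) * U / ((a : ℝ) * L + 1 / 2) ≤ 2 * a * (U / (L + 1)) := by
            rw [div_le_iff₀ hq, mul_div_assoc', div_mul_eq_mul_div, le_div_iff₀ hL1]
            calc (a : ℝ) * U * (L + 1) = U * ((a : ℝ) * (L + 1)) := by ring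
              _ ≤ U * (2 * a * ((a : ℝ) * L + 1 / 2)) := mul_le_mul_of_nonneg_left hcoef hU
              _ = 2 * a * U * ((a : ℝ) * L + 1 / 2) := by ring
          linarith
      _ ≤ 2 * a * (1 + U / (L + 1)) := by
          nlinarith [div_nonneg (Nat.cast_nonneg U) (by positivity : (0:ℝ) ≤ L + 1)]
  have hratio_pos : 0 < Qr / Pr := div_pos (hPpos.trans_le hPQ) hPpos
  calc ∑ n ∈ S, (n : ℝ)⁻¹ ≤ ∑ n ∈ S, 2 * a / d * (((a * n + b) / d : ℕ) : ℝ)⁻¹ :=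
        Finset.sum_le_sum hpt
    _ = 2 * a / d * ∑ n ∈ S, (((a * n + b) / d : ℕ) : ℝ)⁻¹ := by rw [Finset.mul_sum]
    _ = 2 * a / d * ∑ m ∈ S.image (fun n => (a * n + b) / d), (m : ℝ)⁻¹ := by
        rw [Finset.sum_image hinj]
    _ ≤ 2 * a / d * ∑ m ∈ Ioc ⌊Pr⌋₊ ⌊Qr⌋₊, (m : ℝ)⁻¹ :=
        mul_le_mul_of_nonneg_left
          (Finset.sum_le_sum_of_subset_of_nonneg himage fun _ _ _ => by positivity) (by positivity)
    _ ≤ 2 * a / d * (1 + Real.log (Qr / Pr)) :=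
        mul_le_mul_of_nonneg_left (sum_inv_Ioc_floor_le hPpos hPQ) (by positivity)
    _ ≤ 2 * a / d * (1 + Real.log (2 * a * (1 + U / (L + 1)))) := by
        gcongr

/-- A finite family of real thresholds has a common upper bound. [folklore] -/
theorem exists_forall_mem_le {ι : Type*} (s : Finset ι) (T : ι → ℝ) : ∃ M : ℝ, ∀ i ∈ s, T i ≤ M :=
  ⟨∑ j ∈ s, |T j|, fun i hi =>
    (le_abs_self (T i)).trans (Finset.single_le_sum (fun j _ => abs_nonneg (T j)) hi)⟩

end Tao2016

open Tao2016


/-! ## The proof of Proposition 2.2 and of its `g₂`-analogue -/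

section Core

variable {g f : ArithmeticFunction ℂ}

/-- The correlation sum is symmetric in the two factors. [folklore] -/
theorem logCorrelation_swap (g₁ g₂ : ℕ → ℂ) (a₁ b₁ a₂ b₂ : ℕ) (x ω : ℝ) :
    logCorrelation g₁ g₂ a₁ b₁ a₂ b₂ x ω = logCorrelation g₂ g₁ a₂ b₂ a₁ b₁ x ω := by
  unfold logCorrelation
  exact Finset.sum_congr rfl fun n _ => by rw [mul_comm (g₁ _)]

/-- **Twisted Möbius inversion inside the correlation** (Tao 2016, proof of Prop. 2.2: "The
left-hand side of (1.6) can then be rewritten as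
`|∑_d h(d) ∑_{x/ω < n ≤ x : d ∣ a₁n+b₁} g̃₁((a₁n+b₁)/d) g₂(a₂n+b₂) / n|`").
[cite: TaoFMP2016, proof of Proposition 2.2] -/
theorem logCorrelation_eq_sum_cmDefect (g f : ArithmeticFunction ℂ) {a : ℕ} (ha : 1 ≤ a)
    (b a' b' : ℕ) (x ω : ℝ) :
    logCorrelation g f a b a' b' x ω =
      ∑ d ∈ Icc 1 (a * ⌊x⌋₊ + b), cmDefect g d *
        ∑ n ∈ (Ioc ⌊x / ω⌋₊ ⌊x⌋₊).filter (fun n => d ∣ a * n + b),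
          cmLift g ((a * n + b) / d) * f (a' * n + b') / (n : ℂ) := by
  unfold logCorrelation
  set L := ⌊x / ω⌋₊
  set U := ⌊x⌋₊
  set D := a * U + b with hD
  have hexp : ∀ n ∈ Ioc L U, g (a * n + b) * f (a' * n + b') / (n : ℂ)
      = ∑ d ∈ Icc 1 D, if d ∣ a * n + b then
          cmDefect g d * (cmLift g ((a * n + b) / d) * f (a' * n + b') / (n : ℂ)) else 0 := by
    intro n hn
    rw [Finset.mem_Ioc] at hn
    have hm0 : a * n + b ≠ 0 := by
      have : 1 ≤ a * n := Nat.one_le_iff_ne_zero.mpr (Nat.mul_ne_zero (by omega) (by omega))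
      omega
    have hmD : a * n + b ≤ D := by rw [hD]; nlinarith [hn.2]
    have hg' : g (a * n + b)
        = ∑ d ∈ (a * n + b).divisors, cmLift g ((a * n + b) / d) * cmDefect g d := by
      nth_rewrite 1 [← cmLift_mul_cmDefect g]
      rw [ArithmeticFunction.mul_apply,
        Nat.sum_divisorsAntidiagonal' (fun i j => cmLift g i * cmDefect g j)]
    rw [hg', Finset.sum_mul, div_eq_mul_inv, Finset.sum_mul,
      sum_divisors_eq_sum_Icc_ite _ hm0 hmD]
    refine Finset.sum_congr rfl fun d _ => ?_
    split_ifs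
    · rw [div_eq_mul_inv]; ring
    · rfl
  rw [Finset.sum_congr rfl hexp, Finset.sum_comm]
  refine Finset.sum_congr rfl fun d _ => ?_
  rw [Finset.sum_filter, Finset.mul_sum]
  refine Finset.sum_congr rfl fun n _ => ?_
  split_ifs
  · rfl
  · rw [mul_zero]

/-- **Transfer of hypothesis (1.5) to `g̃` and to a smaller height** (Tao 2016, proof of
Prop. 2.2, implicit in "using the hypothesis that Theorem 1.3 holds for completely
multiplicative `g₁`"): if `g'` agrees with the `1`-bounded `g` at primes, `0 < x' ≤ x` and
`A' + 2(1 + log(x/x')) ≤ A`, then hypothesis (1.5) for `g` at level `A`, height `x` implies it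
for `g'` at level `A'`, height `x'` (the primes in `(x', x]` contribute at most
`∑_{x' < p ≤ x} 2/p ≤ 2(1 + log(x/x'))`). [cite: TaoFMP2016, proof of Proposition 2.2] -/
theorem Tao2016_nonpretentiousAt.transfer {g g' : ℕ → ℂ} (hgg' : ∀ p, p.Prime → g' p = g p)
    (hg : ∀ n, ‖g n‖ ≤ 1) {A A' x x' : ℝ} (h : Tao2016_nonpretentiousAt g A x)
    (hx' : 0 < x') (hxx' : x' ≤ x) (hA'0 : 0 ≤ A')
    (hA'A : A' + 2 * (1 + Real.log (x / x')) ≤ A) :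
    Tao2016_nonpretentiousAt g' A' x' := by
  intro q χ t hq hqA' htA'
  have hlog0 : 0 ≤ Real.log (x / x') := Real.log_nonneg ((one_le_div hx').mpr hxx')
  have hA'A' : A' ≤ A := by linarith
  have ht : |t| ≤ A * x := htA'.trans (mul_le_mul hA'A' hxx' hx'.le (hA'0.trans hA'A'))
  have hDist := h q χ t hq (hqA'.trans hA'A') ht
  set T := Sieve.twistedChar χ t with hT
  have hT1 : ∀ n, ‖T n‖ ≤ 1 := Sieve.norm_twistedChar_le_one χ t
  have hre : ∀ p : ℕ, |(g p * (starRingEnd ℂ) (T p)).re| ≤ 1 := fun p =>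
    calc |(g p * (starRingEnd ℂ) (T p)).re| ≤ ‖g p * (starRingEnd ℂ) (T p)‖ :=
          Complex.abs_re_le_norm _
      _ = ‖g p‖ * ‖T p‖ := by rw [norm_mul, Complex.norm_conj]
      _ ≤ 1 * 1 := mul_le_mul (hg p) (hT1 p) (norm_nonneg _) zero_le_one
      _ = 1 := one_mul 1
  have hterm_le : ∀ p : ℕ, (1 - (g p * (starRingEnd ℂ) (T p)).re) / (p : ℝ) ≤ 2 * (p : ℝ)⁻¹ := by
    intro p
    rw [← div_eq_mul_inv]
    refine div_le_div_of_nonneg_right ?_ (Nat.cast_nonneg p)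
    linarith [neg_abs_le ((g p * (starRingEnd ℂ) (T p)).re), hre p]
  have hterm_nn : ∀ p : ℕ, 0 ≤ (1 - (g p * (starRingEnd ℂ) (T p)).re) / (p : ℝ) := by
    intro p
    refine div_nonneg ?_ (Nat.cast_nonneg p)
    linarith [le_abs_self ((g p * (starRingEnd ℂ) (T p)).re), hre p]
  have heq : Sieve.pretentiousDistSq g' T x' = Sieve.pretentiousDistSq g T x' := by
    unfold Sieve.pretentiousDistSq
    refine Finset.sum_congr rfl fun p hp => ?_
    rw [hgg' p (Nat.prime_of_mem_primesLE hp)]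
  have hsub : Nat.primesLE ⌊x'⌋₊ ⊆ Nat.primesLE ⌊x⌋₊ := by
    intro p hp
    rw [Nat.mem_primesLE] at hp ⊢
    exact ⟨hp.1.trans (Nat.floor_le_floor hxx'), hp.2⟩
  have hdiff : Sieve.pretentiousDistSq g T x = Sieve.pretentiousDistSq g T x'
      + ∑ p ∈ Nat.primesLE ⌊x⌋₊ \ Nat.primesLE ⌊x'⌋₊,
          (1 - (g p * (starRingEnd ℂ) (T p)).re) / (p : ℝ) := by
    unfold Sieve.pretentiousDistSq
    rw [← Finset.sum_sdiff hsub]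
    ring
  have hsub2 : Nat.primesLE ⌊x⌋₊ \ Nat.primesLE ⌊x'⌋₊ ⊆ Ioc ⌊x'⌋₊ ⌊x⌋₊ := by
    intro p hp
    rw [Finset.mem_sdiff, Nat.mem_primesLE, Nat.mem_primesLE] at hp
    rw [Finset.mem_Ioc]
    obtain ⟨⟨h1, h2⟩, h3⟩ := hp
    refine ⟨?_, h1⟩
    by_contra hcon
    exact h3 ⟨not_lt.mp hcon, h2⟩
  have hdiff_le : ∑ p ∈ Nat.primesLE ⌊x⌋₊ \ Nat.primesLE ⌊x'⌋₊,
      (1 - (g p * (starRingEnd ℂ) (T p)).re) / (p : ℝ) ≤ 2 * (1 + Real.log (x / x')) :=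
    calc _ ≤ ∑ p ∈ Nat.primesLE ⌊x⌋₊ \ Nat.primesLE ⌊x'⌋₊, 2 * (p : ℝ)⁻¹ :=
          Finset.sum_le_sum fun p _ => hterm_le p
      _ ≤ ∑ n ∈ Ioc ⌊x'⌋₊ ⌊x⌋₊, 2 * (n : ℝ)⁻¹ :=
          Finset.sum_le_sum_of_subset_of_nonneg hsub2 fun _ _ _ => by positivity
      _ = 2 * ∑ n ∈ Ioc ⌊x'⌋₊ ⌊x⌋₊, (n : ℝ)⁻¹ := by rw [Finset.mul_sum]
      _ ≤ 2 * (1 + Real.log (x / x')) :=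
          mul_le_mul_of_nonneg_left (sum_inv_Ioc_floor_le hx' hxx') (by norm_num)
  rw [heq]
  linarith

/-- The final bookkeeping of constants in the proof of Prop. 2.2. [folklore] -/
theorem prop22_final_arith {ε a C K ω : ℝ} (hε : 0 < ε) (hK : 0 < K) (ha : 1 ≤ 4 * a)
    (hKε : 2 * a * C * K ^ (-(1 / 3 : ℝ)) ≤ ε / 8) (hω : 1 ≤ ω)
    (hℓ : 8 / (5 * ε) * (4 * K ^ 3 + ε / 4 * Real.log 4 + ε / 8 * (1 + Real.log (4 * a)))
      ≤ Real.log ω) :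
    K ^ 3 * (4 + ε / (4 * K ^ 3) * (Real.log 4 + Real.log ω))
      + 2 * a * C * K ^ (-(1 / 3 : ℝ)) * (1 + Real.log (4 * a * ω)) ≤ ε * Real.log ω := by
  have hK3 : K ^ 3 ≠ 0 := by positivity
  have h1 : K ^ 3 * (4 + ε / (4 * K ^ 3) * (Real.log 4 + Real.log ω))
      = 4 * K ^ 3 + ε / 4 * Real.log 4 + ε / 4 * Real.log ω := by
    field_simp
    ring
  have hlogω : 0 ≤ Real.log ω := Real.log_nonneg hω
  have hlog4a : 0 ≤ Real.log (4 * a) := Real.log_nonneg ha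
  have hsplit : Real.log (4 * a * ω) = Real.log (4 * a) + Real.log ω :=
    Real.log_mul (by positivity) (by positivity)
  have h2 : 2 * a * C * K ^ (-(1 / 3 : ℝ)) * (1 + Real.log (4 * a * ω))
      ≤ ε / 8 * (1 + Real.log (4 * a) + Real.log ω) := by
    rw [hsplit, ← add_assoc]
    exact mul_le_mul_of_nonneg_right hKε (by positivity)
  have h3 : 4 * K ^ 3 + ε / 4 * Real.log 4 + ε / 8 * (1 + Real.log (4 * a))
      ≤ 5 * ε / 8 * Real.log ω := by
    have := mul_le_mul_of_nonneg_left hℓ (by positivity : (0 : ℝ) ≤ 5 * ε / 8)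
    rwa [← mul_assoc, show 5 * ε / 8 * (8 / (5 * ε)) = 1 by field_simp, one_mul] at this
  rw [h1]
  linarith

/-- The choice of the cut-off `A₀ = K` of Tao's proof of Prop. 2.2 (there called `A₀`): a
natural number `K ≥ max(1, 2b)` with `2 a C K^{-1/3} ≤ ε / 8`. [folklore] -/
theorem prop22_exists_cutoff (a b : ℕ) {ε C : ℝ} (hε : 0 < ε) (hC : 0 < C) :
    ∃ K : ℕ, 1 ≤ K ∧ 2 * b ≤ K ∧ 2 * a * C * (K : ℝ) ^ (-(1 / 3 : ℝ)) ≤ ε / 8 := by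
  refine ⟨⌈(16 * a * C / ε) ^ 3⌉₊ + 2 * b + 1, by omega, by omega, ?_⟩
  set K : ℕ := ⌈(16 * a * C / ε) ^ 3⌉₊ + 2 * b + 1 with hKdef
  have hq : 0 ≤ 16 * a * C / ε := by positivity
  have hKge : (16 * a * C / ε) ^ 3 ≤ (K : ℝ) := by
    refine (Nat.le_ceil _).trans ?_
    rw [hKdef]
    push_cast
    linarith
  have hKpos : (0 : ℝ) < K := by rw [hKdef]; positivity
  have hK3 : 16 * a * C / ε ≤ (K : ℝ) ^ (1 / 3 : ℝ) := by
    rw [show (1 / 3 : ℝ) = (3 : ℝ)⁻¹ by norm_num,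
      Real.le_rpow_inv_iff_of_pos hq hKpos.le (by norm_num : (0 : ℝ) < 3)]
    rw [show (3 : ℝ) = ((3 : ℕ) : ℝ) by norm_num, Real.rpow_natCast]
    exact hKge
  rw [Real.rpow_neg hKpos.le, ← div_eq_mul_inv, div_le_iff₀ (Real.rpow_pos_of_pos hKpos _)]
  calc 2 * (a : ℝ) * C = ε / 8 * (16 * a * C / ε) := by field_simp; ring
    _ ≤ ε / 8 * (K : ℝ) ^ (1 / 3 : ℝ) := mul_le_mul_of_nonneg_left hK3 (by positivity)

/-- **The core of the proof of Tao 2016, Proposition 2.2** (the whole printed argument, for one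
decomposed function `g = g̃ * h` correlated against a `1`-bounded `f`): if the correlations of
`g̃` against `f` along the progressions produced by the change of variables `n = dn' + r`
(`d ≤ K`, `d ∣ ar + b`) obey the conclusion of Theorem 1.3 with `ε'` at level `A'` and height
`(x - r)/d` (the "oracle", supplied by the hypothesis of Prop. 2.2), then
`|∑_{x/ω<n≤x} g(an+b) f(a'n+b')/n| ≤ K³ (4 + ε' (log 4 + log ω)) + 2aC K^{-1/3} (1 + log(4aω))`,
the first term coming from `d ≤ K` (with `|h(d)| ≤ d ≤ K`, at most `d ≤ K` residues, and the
change of variables), the second from `d > K` (triangle inequality, `∑_d |h(d)| d^{-2/3} ≤ C`).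
[cite: TaoFMP2016, proof of Proposition 2.2] -/
theorem cm_reduction_core (hg : g.IsMultiplicative) (hbg : ∀ n, ‖g n‖ ≤ 1)
    (hbf : ∀ n, ‖f n‖ ≤ 1) {a b a' b' K : ℕ} (ha : 1 ≤ a) (hK1 : 1 ≤ K) (hKb : 2 * b ≤ K)
    {ε' A' x ω : ℝ} (hε' : 0 ≤ ε') (hA'1 : 1 ≤ A') (hA'ω : 4 * A' ≤ ω)
    (hA'x : 8 * A' * K ≤ x) (hKx : 2 * (K : ℝ) ≤ x) (hω1 : 1 ≤ ω) (hωx : ω ≤ x)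
    (oracle : ∀ d r : ℕ, 0 < d → d ≤ K → r < d → d ∣ a * r + b →
      ∀ ω' : ℝ, A' ≤ ω' → ω' ≤ (x - r) / d →
        ‖logCorrelation (cmLift g) f a ((a * r + b) / d) (a' * d) (a' * r + b') ((x - r) / d) ω'‖
          ≤ ε' * Real.log ω') :
    ‖logCorrelation g f a b a' b' x ω‖
      ≤ (K : ℝ) ^ 3 * (4 + ε' * (Real.log 4 + Real.log ω))
        + 2 * a * cmDefectBound * (K : ℝ) ^ (-(1 / 3 : ℝ)) * (1 + Real.log (4 * a * ω)) := by
  set L := ⌊x / ω⌋₊ with hL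
  set U := ⌊x⌋₊ with hU
  set D := a * U + b with hD
  set β : ℝ := 4 + ε' * (Real.log 4 + Real.log ω) with hβ
  set Lam : ℝ := 1 + Real.log (4 * a * ω) with hLam
  have hxpos : 0 < x := by linarith
  have hωpos : 0 < ω := by linarith
  have haR : (1 : ℝ) ≤ a := by exact_mod_cast ha
  have hKR : (1 : ℝ) ≤ K := by exact_mod_cast hK1
  have hUx : (U : ℝ) ≤ x := Nat.floor_le hxpos.le
  have hxL : x / ω < L + 1 := Nat.lt_floor_add_one _
  have hLle : (L : ℝ) ≤ x / ω := Nat.floor_le (by positivity)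
  have hxωL : x < ω * (L + 1) := by rwa [div_lt_iff₀' hωpos] at hxL
  have hKU : K ≤ U := Nat.le_floor (by linarith)
  have hlogω : 0 ≤ Real.log ω := Real.log_nonneg hω1
  have hlog4 : 0 ≤ Real.log 4 := Real.log_nonneg (by norm_num)
  have hβ4 : 4 ≤ β := by rw [hβ]; nlinarith
  have hLam1 : 1 ≤ Lam := by
    rw [hLam]
    linarith [Real.log_nonneg (by nlinarith : (1 : ℝ) ≤ 4 * a * ω)]
  have hCpos : 0 < cmDefectBound := Real.exp_pos _
  have hK13 : 0 ≤ (K : ℝ) ^ (-(1 / 3 : ℝ)) := Real.rpow_nonneg (by positivity) _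
  -- the degenerate case `U ≤ L`
  rcases le_or_gt U L with hUL | hLU
  · have : logCorrelation g f a b a' b' x ω = 0 := by
      unfold logCorrelation
      rw [Finset.Ioc_eq_empty (not_lt.mpr hUL), Finset.sum_empty]
    rw [this, norm_zero]
    positivity
  have hUL1 : (U : ℝ) / (L + 1) ≤ ω := by
    rw [div_le_iff₀ (by positivity)]
    linarith
  -- the inner sums `S d`
  set S : ℕ → ℂ := fun d => ∑ n ∈ (Ioc L U).filter (fun n => d ∣ a * n + b),
    cmLift g ((a * n + b) / d) * f (a' * n + b') / (n : ℂ) with hS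
  have hdec : logCorrelation g f a b a' b' x ω = ∑ d ∈ Icc 1 D, cmDefect g d * S d :=
    logCorrelation_eq_sum_cmDefect g f ha b a' b' x ω
  have hbgt : ∀ n, ‖cmLift g n‖ ≤ 1 := norm_cmLift_le_one g (fun p _ => hbg p)
  have hprod : ∀ m m', ‖cmLift g m * f m'‖ ≤ 1 := fun m m' => by
    rw [norm_mul]
    exact mul_le_one₀ (hbgt m) (norm_nonneg _) (hbf m')
  ---- small `d`: one residue class
  have hres : ∀ d, 0 < d → d ≤ K → ∀ r, r < d → d ∣ a * r + b →
      ‖∑ n ∈ (Ioc L U).filter (fun n => n % d = r),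
          cmLift g ((a * n + b) / d) * f (a' * n + b') / (n : ℂ)‖ ≤ β := by
    intro d hd hdK r hr hdvd
    set x' : ℝ := (x - r) / d with hx'
    set X : ℕ → ℂ := fun n' => cmLift g (a * n' + (a * r + b) / d)
      * f (a' * d * n' + (a' * r + b')) with hX
    have hXb : ∀ n', ‖X n'‖ ≤ 1 := fun n' => hprod _ _
    have hYX : ∀ n', (fun n => cmLift g ((a * n + b) / d) * f (a' * n + b')) (d * n' + r)
        = X n' := by
      intro n'
      have h1 : (a * (d * n' + r) + b) / d = a * n' + (a * r + b) / d := by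
        rw [show a * (d * n' + r) + b = d * (a * n') + (a * r + b) by ring, Nat.mul_add_div hd]
      have h2 : a' * (d * n' + r) + b' = a' * d * n' + (a' * r + b') := by ring
      show cmLift g ((a * (d * n' + r) + b) / d) * f (a' * (d * n' + r) + b') = X n'
      rw [h1, h2]
    have hdR : (0 : ℝ) < d := by exact_mod_cast hd
    have hdKR : (d : ℝ) ≤ K := by exact_mod_cast hdK
    have hrK : (r : ℝ) ≤ K := by exact_mod_cast (hr.le.trans hdK)
    have hrU : r ≤ U := (hr.le.trans hdK).trans hKU
    have hC : ‖∑ n ∈ (Ioc L U).filter (fun n => n % d = r),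
        cmLift g ((a * n + b) / d) * f (a' * n + b') / (n : ℂ)‖
          ≤ 3 + ‖∑ n' ∈ Ioc ((L - r) / d) ((U - r) / d), X n' / (n' : ℂ)‖ / d :=
      residueClass_sum_bound hd hr hrU _ X hYX hXb
    have hx'floor : ⌊x'⌋₊ = (U - r) / d := by
      rw [hx', Nat.floor_div_natCast, Nat.floor_sub_natCast]
    have hx'pos : 0 < x' := by
      rw [hx']
      refine div_pos ?_ hdR
      linarith
    have hDor : ∀ ω' : ℝ, A' ≤ ω' → ω' ≤ x' →
        ‖∑ n ∈ Ioc ⌊x' / ω'⌋₊ ⌊x'⌋₊, X n / (n : ℂ)‖ ≤ ε' * Real.log ω' := by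
      intro ω' h1 h2
      have := oracle d r hd hdK hr hdvd ω' h1 h2
      simpa only [logCorrelation, hX, hx'] using this
    set P := (L - r) / d with hP
    have hx'lb : x / (2 * d) ≤ x' := by
      rw [hx']
      calc x / (2 * d) = (x / 2) / d := by rw [div_div]
        _ ≤ (x - r) / d := div_le_div_of_nonneg_right (by linarith) hdR.le
    have hPle : (P : ℝ) ≤ x / (ω * d) := by
      have h1 : P ≤ L / d := Nat.div_le_div_right (Nat.sub_le L r)
      have h2 : (P : ℝ) ≤ ((L / d : ℕ) : ℝ) := by exact_mod_cast h1
      refine h2.trans ?_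
      calc ((L / d : ℕ) : ℝ) ≤ (L : ℝ) / d := Nat.cast_div_le
        _ ≤ (x / ω) / d := by gcongr
        _ = x / (ω * d) := by rw [div_div]
    have hPA : ((P : ℝ) + 2) * A' ≤ x' := by
      have h1 : (P : ℝ) * A' ≤ x / (4 * d) := by
        calc (P : ℝ) * A' ≤ x / (ω * d) * A' := by gcongr
          _ = x * A' / (ω * d) := by ring
          _ ≤ x * A' / (4 * A' * d) := by gcongr
          _ = x / (4 * d) := by field_simp
      have h2 : 2 * A' ≤ x / (4 * d) := by
        rw [le_div_iff₀ (by positivity)]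
        calc 2 * A' * (4 * d) = 8 * A' * d := by ring
          _ ≤ 8 * A' * K := by gcongr
          _ ≤ x := hA'x
      calc ((P : ℝ) + 2) * A' = P * A' + 2 * A' := by ring
        _ ≤ x / (4 * d) + x / (4 * d) := add_le_add h1 h2
        _ = x / (2 * d) := by ring
        _ ≤ x' := hx'lb
    have hT := tail_bound_of_oracle hXb hA'1 hDor P hPA
    rw [hx'floor] at hT
    have hmax : x' / max 1 (P : ℝ) ≤ 4 * ω := by
      have hlt := succ_lt_four_mul_max hd hr L
      have hltR : (L : ℝ) + 1 < 4 * d * max 1 (P : ℝ) := by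
        have := (Nat.cast_lt (α := ℝ)).mpr hlt
        push_cast [Nat.cast_max] at this
        exact this
      have hm1 : (1 : ℝ) ≤ max 1 (P : ℝ) := le_max_left _ _
      have hx'le : x' ≤ x / d := by
        rw [hx']
        exact div_le_div_of_nonneg_right (by linarith) hdR.le
      calc x' / max 1 (P : ℝ) ≤ (x / d) / max 1 (P : ℝ) := by gcongr
        _ = x / (d * max 1 (P : ℝ)) := by rw [div_div]
        _ ≤ (ω * (L + 1)) / (d * max 1 (P : ℝ)) := by gcongr
        _ ≤ (ω * (4 * d * max 1 (P : ℝ))) / (d * max 1 (P : ℝ)) := by gcongr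
        _ = 4 * ω := by field_simp
    have hlog : Real.log (x' / max 1 (P : ℝ)) ≤ Real.log 4 + Real.log ω := by
      rw [← Real.log_mul (by norm_num) hωpos.ne']
      exact Real.log_le_log (div_pos hx'pos (by positivity)) hmax
    have hnn : 0 ≤ ‖∑ n ∈ Ioc P ((U - r) / d), X n / (n : ℂ)‖ := norm_nonneg _
    have hdiv : ‖∑ n ∈ Ioc P ((U - r) / d), X n / (n : ℂ)‖ / d
        ≤ ‖∑ n ∈ Ioc P ((U - r) / d), X n / (n : ℂ)‖ :=
      div_le_self hnn (by exact_mod_cast hd)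
    have hεlog : ε' * Real.log (x' / max 1 (P : ℝ)) ≤ ε' * (Real.log 4 + Real.log ω) :=
      mul_le_mul_of_nonneg_left hlog hε'
    calc _ ≤ 3 + ‖∑ n' ∈ Ioc P ((U - r) / d), X n' / (n' : ℂ)‖ / d := hC
      _ ≤ 3 + (1 + ε' * Real.log (x' / max 1 (P : ℝ))) := by linarith
      _ ≤ β := by rw [hβ]; linarith
  ---- small `d`: one `d`
  have hsmall : ∀ d ∈ (Icc 1 D).filter (fun d => d ≤ K),
      ‖cmDefect g d * S d‖ ≤ (K : ℝ) ^ 2 * β := by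
    intro d hd'
    obtain ⟨hdI, hdK⟩ := Finset.mem_filter.mp hd'
    have hd : 0 < d := (Finset.mem_Icc.mp hdI).1
    rw [norm_mul]
    have h1 : ‖cmDefect g d‖ ≤ K :=
      (norm_cmDefect_le_self g hg hbg d).trans (by exact_mod_cast hdK)
    have h2 : ‖S d‖ ≤ d * β := by
      simp only [hS]
      rw [sum_filter_dvd_eq_sum_residues
        (fun n => cmLift g ((a * n + b) / d) * f (a' * n + b') / (n : ℂ)) hd a b (Ioc L U)]
      refine (norm_sum_le _ _).trans ?_
      calc ∑ r ∈ (range d).filter (fun r => d ∣ a * r + b),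
            ‖∑ n ∈ (Ioc L U).filter (fun n => n % d = r),
              cmLift g ((a * n + b) / d) * f (a' * n + b') / (n : ℂ)‖
            ≤ ∑ r ∈ (range d).filter (fun r => d ∣ a * r + b), β :=
            Finset.sum_le_sum fun r hr' =>
              hres d hd hdK r (Finset.mem_range.mp (Finset.mem_filter.mp hr').1)
                (Finset.mem_filter.mp hr').2
        _ = (((range d).filter (fun r => d ∣ a * r + b)).card : ℝ) * β := by
            rw [Finset.sum_const, nsmul_eq_mul]
        _ ≤ d * β :=
            mul_le_mul_of_nonneg_right
              (by exact_mod_cast (Finset.card_filter_le _ _).trans (Finset.card_range d).le)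
              (by linarith)
    have h3 : (d : ℝ) * β ≤ K * β :=
      mul_le_mul_of_nonneg_right (by exact_mod_cast hdK) (by linarith)
    calc ‖cmDefect g d‖ * ‖S d‖ ≤ K * (K * β) :=
          mul_le_mul h1 (h2.trans h3) (norm_nonneg _) (by positivity)
      _ = (K : ℝ) ^ 2 * β := by ring
  ---- large `d`: one `d`
  have hlarge : ∀ d ∈ (Icc 1 D).filter (fun d => ¬d ≤ K),
      ‖cmDefect g d * S d‖ ≤ 2 * a * Lam * (K : ℝ) ^ (-(1 / 3 : ℝ)) * defectWeight g d := by
    intro d hd'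
    obtain ⟨-, hdK⟩ := Finset.mem_filter.mp hd'
    rw [not_le] at hdK
    have hd : 0 < d := by omega
    have hdR : (0 : ℝ) < d := by exact_mod_cast hd
    rw [norm_mul]
    have hS1 : ‖S d‖ ≤ 2 * a / d * Lam := by
      refine (norm_sum_le _ _).trans ?_
      refine (Finset.sum_le_sum fun n _ => norm_div_natCast_le (hprod _ _) n).trans ?_
      refine (sum_inv_filter_dvd_le ha (by omega : 2 * b < d) hLU).trans ?_
      refine mul_le_mul_of_nonneg_left ?_ (by positivity)
      rw [hLam]
      refine add_le_add le_rfl (Real.log_le_log (by positivity) ?_)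
      nlinarith [mul_le_mul_of_nonneg_left hUL1 (by positivity : (0 : ℝ) ≤ 2 * a)]
    have hw : ‖cmDefect g d‖ / d ≤ (K : ℝ) ^ (-(1 / 3 : ℝ)) * defectWeight g d := by
      unfold defectWeight
      have hsplit : (d : ℝ)⁻¹ = (d : ℝ) ^ (-(2 / 3 : ℝ)) * (d : ℝ) ^ (-(1 / 3 : ℝ)) := by
        rw [← Real.rpow_add hdR, ← Real.rpow_neg_one]
        norm_num
      have hK13' : (d : ℝ) ^ (-(1 / 3 : ℝ)) ≤ (K : ℝ) ^ (-(1 / 3 : ℝ)) :=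
        Real.rpow_le_rpow_of_nonpos (by positivity) (by exact_mod_cast hdK.le) (by norm_num)
      rw [div_eq_mul_inv, hsplit]
      calc ‖cmDefect g d‖ * ((d : ℝ) ^ (-(2 / 3 : ℝ)) * (d : ℝ) ^ (-(1 / 3 : ℝ)))
            = ‖cmDefect g d‖ * (d : ℝ) ^ (-(2 / 3 : ℝ)) * (d : ℝ) ^ (-(1 / 3 : ℝ)) := by ring
        _ ≤ ‖cmDefect g d‖ * (d : ℝ) ^ (-(2 / 3 : ℝ)) * (K : ℝ) ^ (-(1 / 3 : ℝ)) :=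
            mul_le_mul_of_nonneg_left hK13' (by positivity)
        _ = (K : ℝ) ^ (-(1 / 3 : ℝ)) * (‖cmDefect g d‖ * (d : ℝ) ^ (-(2 / 3 : ℝ))) := by ring
    calc ‖cmDefect g d‖ * ‖S d‖ ≤ ‖cmDefect g d‖ * (2 * a / d * Lam) :=
          mul_le_mul_of_nonneg_left hS1 (norm_nonneg _)
      _ = 2 * a * Lam * (‖cmDefect g d‖ / d) := by ring
      _ ≤ 2 * a * Lam * ((K : ℝ) ^ (-(1 / 3 : ℝ)) * defectWeight g d) :=
          mul_le_mul_of_nonneg_left hw (by positivity)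
      _ = _ := by ring
  ---- assembly
  rw [hdec]
  refine (norm_sum_le _ _).trans ?_
  rw [← Finset.sum_filter_add_sum_filter_not (Icc 1 D) (fun d => d ≤ K)]
  have hsum1 : ∑ d ∈ (Icc 1 D).filter (fun d => d ≤ K), ‖cmDefect g d * S d‖
      ≤ (K : ℝ) ^ 3 * β := by
    refine (Finset.sum_le_sum hsmall).trans ?_
    rw [Finset.sum_const, nsmul_eq_mul]
    have hsub : (Icc 1 D).filter (fun d => d ≤ K) ⊆ Icc 1 K := by
      intro d hd
      simp only [Finset.mem_filter, Finset.mem_Icc] at hd ⊢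
      omega
    have hcard : (((Icc 1 D).filter (fun d => d ≤ K)).card : ℝ) ≤ K := by
      have := Finset.card_le_card hsub
      rw [Nat.card_Icc] at this
      exact_mod_cast this.trans (by omega)
    calc (((Icc 1 D).filter (fun d => d ≤ K)).card : ℝ) * ((K : ℝ) ^ 2 * β)
          ≤ K * ((K : ℝ) ^ 2 * β) := mul_le_mul_of_nonneg_right hcard (by positivity)
      _ = (K : ℝ) ^ 3 * β := by ring
  have hsum2 : ∑ d ∈ (Icc 1 D).filter (fun d => ¬d ≤ K), ‖cmDefect g d * S d‖
      ≤ 2 * a * cmDefectBound * (K : ℝ) ^ (-(1 / 3 : ℝ)) * Lam := by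
    refine (Finset.sum_le_sum hlarge).trans ?_
    rw [← Finset.mul_sum]
    have hW : ∑ d ∈ (Icc 1 D).filter (fun d => ¬d ≤ K), defectWeight g d ≤ cmDefectBound :=
      (Finset.sum_le_sum_of_subset_of_nonneg (Finset.filter_subset _ _)
        (fun d _ _ => defectWeight_nonneg g d)).trans (sum_defectWeight_le g hg hbg D)
    calc 2 * a * Lam * (K : ℝ) ^ (-(1 / 3 : ℝ))
          * ∑ d ∈ (Icc 1 D).filter (fun d => ¬d ≤ K), defectWeight g d
          ≤ 2 * a * Lam * (K : ℝ) ^ (-(1 / 3 : ℝ)) * cmDefectBound :=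
          mul_le_mul_of_nonneg_left hW (by positivity)
      _ = _ := by ring
  linarith

end Core

/-! ### Proposition 2.2 and its `g₂`-analogue -/

section Prop22

/-- Hypothesis (1.5) only involves prime values. [folklore] -/
theorem Tao2016_nonpretentiousAt.congr_primes {g g' : ℕ → ℂ} {A x : ℝ}
    (hgg' : ∀ p, p.Prime → g' p = g p) (h : Tao2016_nonpretentiousAt g A x) :
    Tao2016_nonpretentiousAt g' A x := by
  intro q χ t hq hqA htA
  have heq : Sieve.pretentiousDistSq g' (Sieve.twistedChar χ t) x
      = Sieve.pretentiousDistSq g (Sieve.twistedChar χ t) x := by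
    unfold Sieve.pretentiousDistSq
    refine Finset.sum_congr rfl fun p hp => ?_
    rw [hgg' p (Nat.prime_of_mem_primesLE hp)]
  rw [heq]
  exact h q χ t hq hqA htA

/-- `g̃` is `S¹`-valued and completely multiplicative when `g` is `S¹`-valued. [folklore] -/
theorem isCircleValuedCM_cmLift {g : ArithmeticFunction ℂ} (hc : IsCircleValued g) :
    IsCircleValuedCM (cmLift g) :=
  ⟨fun _ hn => norm_cmLift_eq_one g (fun p hp => hc p hp.ne_zero) hn, fun m n => cmLift_mul g m n⟩

/-- **The engine of Tao 2016, Proposition 2.2** (shared by Prop. 2.2 and its `g₂`-analogue):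
the choice of the cut-off `K` ("`A₀`" in the paper) and of `A` large in terms of `K`, the
thresholds of the finitely many instances `(d, r)`, `d ≤ K`, of the hypothesis, the transfer of
hypothesis (1.5) to height `(x - r)/d` and level `A / 8K`, and the final bookkeeping, around
`cm_reduction_core`.  `Rs` collects the static side conditions on the pair `(g, f)` (`g` the
function being made completely multiplicative), `N g f A x` the level/height-dependent one
(hypothesis (1.5) for `g` or for `f`), assumed stable under lowering the level by
`2(1 + log(x/x'))` when passing to a height `x' ≤ x`.
[cite: TaoFMP2016, proof of Proposition 2.2] -/
theorem prop22_engine {a b a' b' : ℕ} (ha : 1 ≤ a)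
    (Rs : ArithmeticFunction ℂ → ArithmeticFunction ℂ → Prop)
    (N : ArithmeticFunction ℂ → ArithmeticFunction ℂ → ℝ → ℝ → Prop)
    (hN : ∀ (g f : ArithmeticFunction ℂ) (A x A' x' : ℝ), (∀ n, ‖g n‖ ≤ 1) → (∀ n, ‖f n‖ ≤ 1) →
      N g f A x → 0 < x' → x' ≤ x → 0 ≤ A' → A' + 2 * (1 + Real.log (x / x')) ≤ A → N g f A' x')
    (Hyp : ∀ d r : ℕ, 0 < d → d ∣ a * r + b → ∀ ε' : ℝ, 0 < ε' → ∃ T : ℝ, ∀ A' : ℝ, T ≤ A' →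
      ∀ x' ω' : ℝ, A' ≤ ω' → ω' ≤ x' → ∀ g f : ArithmeticFunction ℂ,
        g.IsMultiplicative → (∀ n, ‖g n‖ ≤ 1) → (∀ n, ‖f n‖ ≤ 1) → Rs g f → N g f A' x' →
        ‖logCorrelation (cmLift g) f a ((a * r + b) / d) (a' * d) (a' * r + b') x' ω'‖
          ≤ ε' * Real.log ω')
    {ε : ℝ} (hε : 0 < ε) :
    ∃ A₀ : ℝ, ∀ A : ℝ, A₀ ≤ A → ∀ x ω : ℝ, A ≤ ω → ω ≤ x → ∀ g f : ArithmeticFunction ℂ,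
      g.IsMultiplicative → (∀ n, ‖g n‖ ≤ 1) → (∀ n, ‖f n‖ ≤ 1) → Rs g f → N g f A x →
        ‖logCorrelation g f a b a' b' x ω‖ ≤ ε * Real.log ω := by
  have hCpos : 0 < cmDefectBound := Real.exp_pos _
  obtain ⟨K, hK1, hKb, hKε⟩ := prop22_exists_cutoff a b hε hCpos
  have hKR : (1 : ℝ) ≤ K := by exact_mod_cast hK1
  have hKpos : (0 : ℝ) < K := by positivity
  have haR : (1 : ℝ) ≤ a := by exact_mod_cast ha
  obtain ⟨ε', hε'⟩ : ∃ ε' : ℝ, ε' = ε / (4 * (K : ℝ) ^ 3) := ⟨_, rfl⟩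
  have hε'pos : 0 < ε' := by rw [hε']; positivity
  -- thresholds, one for each `(d, r)`
  have hT : ∀ d r : ℕ, ∃ T : ℝ, 0 < d → d ∣ a * r + b → ∀ A' : ℝ, T ≤ A' →
      ∀ x' ω' : ℝ, A' ≤ ω' → ω' ≤ x' → ∀ g f : ArithmeticFunction ℂ,
        g.IsMultiplicative → (∀ n, ‖g n‖ ≤ 1) → (∀ n, ‖f n‖ ≤ 1) → Rs g f → N g f A' x' →
        ‖logCorrelation (cmLift g) f a ((a * r + b) / d) (a' * d) (a' * r + b') x' ω'‖
          ≤ ε' * Real.log ω' := by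
    intro d r
    by_cases hd : 0 < d
    · by_cases hdvd : d ∣ a * r + b
      · obtain ⟨T, hT⟩ := Hyp d r hd hdvd ε' hε'pos
        exact ⟨T, fun _ _ => hT⟩
      · exact ⟨0, fun _ h => absurd h hdvd⟩
    · exact ⟨0, fun h => absurd h hd⟩
  choose T hT using hT
  obtain ⟨Tm, hTm⟩ := exists_forall_mem_le (range (K + 1) ×ˢ range (K + 1)) (fun p => T p.1 p.2)
  set T₀ : ℝ := max Tm 1 with hT₀
  have hT₀1 : 1 ≤ T₀ := le_max_right _ _
  set ℓ₀ : ℝ := 8 / (5 * ε) * (4 * (K : ℝ) ^ 3 + ε / 4 * Real.log 4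
    + ε / 8 * (1 + Real.log (4 * a))) with hℓ₀
  refine ⟨max (8 * K * T₀ + 8 * K + 4) (Real.exp ℓ₀), ?_⟩
  intro A hA x ω hAω hωx g f hg hbg hbf hRs hNgf
  have hA1 : 8 * K * T₀ + 8 * K + 4 ≤ A := (le_max_left _ _).trans hA
  have hA2 : Real.exp ℓ₀ ≤ A := (le_max_right _ _).trans hA
  have hKT₀ : 0 ≤ (K : ℝ) * T₀ := by positivity
  have hApos : 0 < A := by linarith
  have hxA : A ≤ x := hAω.trans hωx
  have hω1 : 1 ≤ ω := by linarith
  have h2Kx : 2 * (K : ℝ) ≤ x := by linarith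
  obtain ⟨A', hA'⟩ : ∃ A' : ℝ, A' = A / (8 * K) := ⟨_, rfl⟩
  have h8 : 8 * A' * K = A := by rw [hA']; field_simp
  have hA'T₀ : T₀ ≤ A' := by
    rw [hA', le_div_iff₀ (by positivity)]
    linarith
  have hA'1 : 1 ≤ A' := hT₀1.trans hA'T₀
  have hA'le : A' ≤ A / 8 := by
    rw [hA']
    exact div_le_div_of_nonneg_left hApos.le (by norm_num) (by linarith)
  have hA'ω : 4 * A' ≤ ω := by linarith
  -- the oracle
  have horacle : ∀ d r : ℕ, 0 < d → d ≤ K → r < d → d ∣ a * r + b →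
      ∀ ω' : ℝ, A' ≤ ω' → ω' ≤ (x - r) / d →
        ‖logCorrelation (cmLift g) f a ((a * r + b) / d) (a' * d) (a' * r + b') ((x - r) / d) ω'‖
          ≤ ε' * Real.log ω' := by
    intro d r hd hdK hr hdvd ω' h1 h2
    have hTdr : T d r ≤ A' := by
      have hmem : (d, r) ∈ range (K + 1) ×ˢ range (K + 1) := by
        rw [Finset.mem_product, Finset.mem_range, Finset.mem_range]
        omega
      exact ((hTm (d, r) hmem).trans (le_max_left _ _)).trans hA'T₀
    have hdR : (0 : ℝ) < d := by exact_mod_cast hd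
    have hd1 : (1 : ℝ) ≤ d := by exact_mod_cast hd
    have hrK : (r : ℝ) ≤ K := by exact_mod_cast (hr.le.trans hdK)
    have hdKR : (d : ℝ) ≤ K := by exact_mod_cast hdK
    have hxr : 0 < x - r := by linarith
    have hx'pos : 0 < (x - r) / d := div_pos hxr hdR
    have hx'le : (x - r) / d ≤ x := (div_le_self hxr.le hd1).trans (by linarith)
    refine hT d r hd hdvd A' hTdr ((x - r) / d) ω' h1 h2 g f hg hbg hbf hRs ?_
    refine hN g f A x A' ((x - r) / d) hbg hbf hNgf hx'pos hx'le (by linarith) ?_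
    have hratio : x / ((x - r) / d) ≤ 2 * K := by
      rw [div_div_eq_mul_div, div_le_iff₀ hxr]
      calc x * d ≤ x * K := mul_le_mul_of_nonneg_left hdKR (by linarith)
        _ ≤ 2 * K * (x - r) := by
            nlinarith [mul_nonneg hKpos.le (sub_nonneg.mpr h2Kx),
              mul_nonneg hKpos.le (sub_nonneg.mpr hrK)]
    have hlogle : Real.log (x / ((x - r) / d)) ≤ 2 * K :=
      calc Real.log (x / ((x - r) / d)) ≤ Real.log (2 * K) :=
            Real.log_le_log (div_pos (by linarith) hx'pos) hratio
        _ ≤ 2 * K - 1 := Real.log_le_sub_one_of_pos (by positivity)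
        _ ≤ 2 * K := by linarith
    linarith
  -- the core and the bookkeeping
  have h8x : 8 * A' * K ≤ x := h8.le.trans hxA
  have hcore := cm_reduction_core hg hbg hbf ha hK1 hKb hε'pos.le hA'1 hA'ω h8x h2Kx
    hω1 hωx horacle
  refine hcore.trans ?_
  have hℓ : ℓ₀ ≤ Real.log ω := by
    rw [← Real.log_exp ℓ₀]
    exact Real.log_le_log (Real.exp_pos _) (hA2.trans hAω)
  have := prop22_final_arith (C := cmDefectBound) hε hKpos (by linarith : (1 : ℝ) ≤ 4 * a)
    hKε hω1 hℓ
  rw [hε']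
  exact this

/-- A linear-forms identity used for the non-degeneracy of the new parameters. [folklore] -/
private theorem nondeg_aux {a₁ a₂ b₁ b₂ d r : ℕ} (hab : a₁ * b₂ ≠ a₂ * b₁)
    (hdvd : d ∣ a₁ * r + b₁) : a₁ * (a₂ * r + b₂) ≠ a₂ * d * ((a₁ * r + b₁) / d) := by
  rw [mul_assoc a₂ d, Nat.mul_div_cancel' hdvd]
  intro h
  apply hab
  have hz : ((a₁ : ℤ) * (a₂ * r + b₂) : ℤ) = a₂ * (a₁ * r + b₁) := by exact_mod_cast h
  have hz' : ((a₁ : ℤ) * b₂ : ℤ) = a₂ * b₁ := by linear_combination hz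
  exact_mod_cast hz'

/-- **PROVED — Tao 2016, Proposition 2.2** (`Literature.NumberTheory.LFunctions.Tao2016_prop22`): Theorem 1.3 for
(`g₁` completely multiplicative `S¹`-valued, `g₂` `S¹`-valued) implies Theorem 1.3 for
`S¹`-valued `g₁, g₂`.  Proof as printed: `g₁ = g̃₁ * h` (twisted Möbius inversion, `cmLift`,
`cmDefect`), the terms `d ≤ A₀` by the hypothesis after the change of variables `n = dn' + r`
in each residue class (`cm_reduction_core`, `residueClass_sum_bound`, `tail_bound_of_oracle`),
the terms `d > A₀` by the triangle inequality and `∑_d |h(d)| d^{-2/3} = O(1)`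
(`sum_defectWeight_le`). [cite: TaoFMP2016, Proposition 2.2] -/
theorem Tao2016_prop22_holds : Tao2016_prop22 := by
  intro H a₁ a₂ b₁ b₂ ha₁ ha₂ hab ε hε
  have hHyp : ∀ d r : ℕ, 0 < d → d ∣ a₁ * r + b₁ → ∀ ε' : ℝ, 0 < ε' → ∃ T : ℝ, ∀ A' : ℝ,
      T ≤ A' → ∀ x' ω' : ℝ, A' ≤ ω' → ω' ≤ x' → ∀ g f : ArithmeticFunction ℂ,
        g.IsMultiplicative → (∀ n, ‖g n‖ ≤ 1) → (∀ n, ‖f n‖ ≤ 1) →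
        (IsCircleValued g ∧ f.IsMultiplicative ∧ IsCircleValued f) →
        Tao2016_nonpretentiousAt g A' x' →
        ‖logCorrelation (cmLift g) f a₁ ((a₁ * r + b₁) / d) (a₂ * d) (a₂ * r + b₂) x' ω'‖
          ≤ ε' * Real.log ω' := by
    intro d r hd hdvd ε' hε'
    obtain ⟨T, hT⟩ := H a₁ (a₂ * d) ((a₁ * r + b₁) / d) (a₂ * r + b₂) ha₁
      (Nat.one_le_iff_ne_zero.mpr (Nat.mul_ne_zero (by omega) (by omega))) (nondeg_aux hab hdvd)
      ε' hε'
    refine ⟨T, fun A' hA' x' ω' h1 h2 g f _ hbg hbf hRs hN => ?_⟩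
    obtain ⟨hcg, hf, hcf⟩ := hRs
    exact hT A' hA' x' ω' h1 h2 (cmLift g) f (isMultiplicative_cmLift g) hf
      (norm_cmLift_le_one g fun p _ => hbg p) hbf (isCircleValuedCM_cmLift hcg) hcf
      (hN.congr_primes fun p hp => cmLift_prime g hp)
  obtain ⟨A₀, hA₀⟩ := prop22_engine (a := a₁) (b := b₁) (a' := a₂) (b' := b₂) ha₁
    (fun g f => IsCircleValued g ∧ f.IsMultiplicative ∧ IsCircleValued f)
    (fun g _ A x => Tao2016_nonpretentiousAt g A x)
    (fun g f A x A' x' hbg _ hNx hx' hxx' hA' hAA' =>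
      Tao2016_nonpretentiousAt.transfer (fun _ _ => rfl) hbg hNx hx' hxx' hA' hAA')
    hHyp hε
  exact ⟨A₀, fun A hA x ω hAω hωx g₁ g₂ hg₁ hg₂ hb₁ hb₂ hP₁ hP₂ hhyp =>
    hA₀ A hA x ω hAω hωx g₁ g₂ hg₁ hb₁ hb₂ ⟨hP₁, hg₂, hP₂⟩ hhyp⟩

/-- **PROVED — Tao 2016, §2, the sentence following the proof of Proposition 2.2**
(`Literature.NumberTheory.LFunctions.Tao2016_prop22_right`): "A similar argument allows one to also reduce to the case where
`g₂` is completely multiplicative": the same engine applied to `g₂ = g̃₂ * h₂` (the correlation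
is symmetric in the two factors, and hypothesis (1.5), which concerns `g₁`, is only moved to the
height `(x - r)/d` and the level `A/8K`).
[cite: TaoFMP2016, §2 (paragraph after the proof of Proposition 2.2)] -/
theorem Tao2016_prop22_right_holds : Tao2016_prop22_right := by
  intro H a₁ a₂ b₁ b₂ ha₁ ha₂ hab ε hε
  have hab' : a₂ * b₁ ≠ a₁ * b₂ := fun h => hab h.symm
  have hHyp : ∀ d r : ℕ, 0 < d → d ∣ a₂ * r + b₂ → ∀ ε' : ℝ, 0 < ε' → ∃ T : ℝ, ∀ A' : ℝ,
      T ≤ A' → ∀ x' ω' : ℝ, A' ≤ ω' → ω' ≤ x' → ∀ g f : ArithmeticFunction ℂ,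
        g.IsMultiplicative → (∀ n, ‖g n‖ ≤ 1) → (∀ n, ‖f n‖ ≤ 1) →
        (IsCircleValued g ∧ f.IsMultiplicative ∧ IsCircleValuedCM f) →
        Tao2016_nonpretentiousAt f A' x' →
        ‖logCorrelation (cmLift g) f a₂ ((a₂ * r + b₂) / d) (a₁ * d) (a₁ * r + b₁) x' ω'‖
          ≤ ε' * Real.log ω' := by
    intro d r hd hdvd ε' hε'
    obtain ⟨T, hT⟩ := H (a₁ * d) a₂ (a₁ * r + b₁) ((a₂ * r + b₂) / d)
      (Nat.one_le_iff_ne_zero.mpr (Nat.mul_ne_zero (by omega) (by omega))) ha₂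
      (fun h => nondeg_aux hab' hdvd h.symm) ε' hε'
    refine ⟨T, fun A' hA' x' ω' h1 h2 g f _ hbg hbf hRs hN => ?_⟩
    obtain ⟨hcg, hf, hcf⟩ := hRs
    rw [logCorrelation_swap]
    exact hT A' hA' x' ω' h1 h2 f (cmLift g) hf (isMultiplicative_cmLift g) hbf
      (norm_cmLift_le_one g fun p _ => hbg p) hcf (isCircleValuedCM_cmLift hcg) hN
  obtain ⟨A₀, hA₀⟩ := prop22_engine (a := a₂) (b := b₂) (a' := a₁) (b' := b₁) ha₂
    (fun g f => IsCircleValued g ∧ f.IsMultiplicative ∧ IsCircleValuedCM f)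
    (fun _ f A x => Tao2016_nonpretentiousAt f A x)
    (fun g f A x A' x' _ hbf hNx hx' hxx' hA' hAA' =>
      Tao2016_nonpretentiousAt.transfer (fun _ _ => rfl) hbf hNx hx' hxx' hA' hAA')
    hHyp hε
  refine ⟨A₀, fun A hA x ω hAω hωx g₁ g₂ hg₁ hg₂ hb₁ hb₂ hP₁ hP₂ hhyp => ?_⟩
  rw [logCorrelation_swap]
  exact hA₀ A hA x ω hAω hωx g₂ g₁ hg₂ hb₂ hb₁ ⟨hP₂, hg₁, hP₁⟩ hhyp

end Prop22

end Literature.NumberTheory.LFunctions
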